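import Mathlib
import HarnessLib

/-!
# Tao's quadric example for a general nondegenerate form: the "unit sphere" `{⟨x, x⟩ = 1} ⊂ F⁴`
(Tao 2005, Proposition 1.3)

Topic `Literature/Combinatorics/Kakeya`.  Everything in this file is PROVED (no named fact, no
`sorry`).  Companion to `Literature.Combinatorics.Kakeya.Tao2005Quadric`, which treats the split
form `⟨x, x⟩ = det x` on `M₂(K) ≅ K⁴` with exact counts; here the form is an ARBITRARY
nondegenerate symmetric bilinear form on a `4`-dimensional space, as in the printed proposition,
and the cardinalities come with explicit (non-sharp) absolute constants.

T. Tao, *A new bound for finite field Besicovitch sets in four dimensions*, Pacific J. Math.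
**222** (2005), no. 2, 337–363 (doi:10.2140/pjm.2005.222.337), §1, p. 338, verbatim from the printed
journal text (the arXiv version, math/0204251, numbers the same items Definition 1,
Proposition 3 and — for Lemma 3.1 — Lemma 5, with the same mathematical content):

> **Definition 1.1.** A family `L` of lines in `Fⁿ` is said to obey the *Wolff axiom* if for
> every `2 ≤ k ≤ n − 1`, every `k`-dimensional affine subspace `V ⊂ Fⁿ` contains at most
> `O(|F|^{k−1})` lines in `L`. (Here we view the field `F` as being quite large, and the family `L`
> as depending on `F`. The implied constant in the `O( )` notation may depend on `n` and `k` but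
> is uniform in `F`. Also Recall that an affine subspace is a translate of a vector subspace of
> `Fⁿ`.)
>
> **Proposition 1.3.** Let `⟨ , ⟩ : F⁴ × F⁴ → F` be a nondegenerate symmetric quadratic form on
> `F⁴`. Let `P` be the "unit sphere" (1–1) `P := {x ∈ F⁴ : ⟨x, x⟩ = 1}` and let `L` be the set
> of all lines of the form `{x + tv : t ∈ F}`, where `x ∈ F⁴`, `v ∈ F⁴ ∖ {0}` are such that
> `⟨x, x⟩ = 1`, `⟨v, x⟩ = 0`, and `⟨v, v⟩ = 0`. Then `L` has cardinality `|L| ∼ |F|³` and obeys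
> the Wolff axiom, while `P` has cardinality `|P| ∼ |F|³` and contains all the lines in `L`.

(`A ≲ B` means `A ≤ C B` for a universal constant `C`, and `A ∼ B` means `A ≲ B ≲ A`, p. 338.)
The proof is §3 ("The counterexample", pp. 340–342): **Lemma 3.1** — for a symmetric bilinear
form of rank `≥ 1` on `Fⁿ` with quadratic form `Q`, `|{x ∈ Fⁿ : Q(x) = c}| ≲ |F|^{n−1}` (3–1),
and `∼ |F|^{n−1}` if the rank is `≥ 3` and `|F|` is large (3–2) (`char F ≠ 2`; proved there by
diagonalising and, for (3–2), by Gauss sums); then "`|P| ∼ |F|³`" by the lemma, "`∼ |F|⁵`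
possible pairs `(x, v)` that generate a line in `L`. However, each line in `L` is generated by
`∼ |F|²` such pairs `(x, v)`, so we have `|L| ∼ |F|³`", and for the Wolff axiom, for a `3`-space
`λ = x₀ + (λ − x₀)`: "the number of null vectors `{v ∈ λ − x₀ : ⟨v, v⟩ = 0}` is `O(|F|²)` …
Thus the number of lines in `λ` is at most `O(|F|)`, which clearly implies the Wolff axiom for
both `k = 2` and `k = 3`."

## Setting and definitions

`K` is a field and `V` a `K`-vector space; the main theorems assume `finrank K V = 4` (Tao's
`F⁴`; `prop13_fin` is the literal case `V = Fin 4 → K`), `B : LinearMap.BilinForm K V` with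
`B.Nondegenerate` and `B.IsSymm` (Tao's `⟨ , ⟩`), and `(2 : K) ≠ 0` — Tao's standing assumption
`char F ≠ 2`, recalled in the proof of Lemma 3.1 (`Ring.two_ne_zero` converts from
`ringChar K ≠ 2`; conversely `ringChar_ne_two`).  Where cardinalities occur `K` is finite and
`q := Nat.card K`, so that `q` is odd and `q ≥ 3` (`two_lt_card`).
* `line K x v = {x + t v : t ∈ K}` — Tao's lines (§2, p. 340), with `v ≠ 0` required by the
  families below;
* `sphere B = {x | B x x = 1}` — Tao's `P`, eq. (1–1);
* `lineSet B` — Tao's `L`, verbatim: the lines `line K x v` with `v ≠ 0`, `B x x = 1`,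
  `B v x = 0`, `B v v = 0`;
* `translate x₀ W = x₀ + W` for a submodule `W` — "an affine subspace is a translate of a vector
  subspace of `Fⁿ`" (Def. 1.1), `k`-dimensional meaning `finrank K W = k`;
* `lineSetIn B S` (the lines of `L` contained in `S`), `linesThroughIn B p S` (those through `p`),
  `genPairs B` (the generating pairs `(x, v)`), `gen` (the line a pair generates).

## What is proved (`prop13` is the conjunction, `prop13_fin` its `Fin 4 → K` instance)

* `subset_sphere_of_mem_lineSet` — "`P` … contains all the lines in `L`" (any field); conversely
  `line_subset_sphere_iff`, `mem_lineSet_iff` — for `|K| ≥ 3`, `L` is the set of *all* lines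
  contained in `P`.
* `ncard_sphere_le`, `mul_sq_le_ncard_sphere` — **`q (q − 2)² ≤ |P| ≤ 2 q³`** ("`|P| ∼ |F|³`").
* `ncard_lineSet_le`, `cube_le_ncard_lineSet` — **`(q − 2)³ ≤ |L| ≤ 6 q³`** ("`|L| ∼ |F|³`"),
  through `ncard_lineSet_mul_eq` (`|L| · q (q − 1) = #genPairs`; `natCard_fiber`: each line of
  `L` is generated by exactly `q (q − 1)` pairs), `ncard_genPairs_le` (`#genPairs ≤ 4 q⁵`) and
  `ncard_sphere_mul_le_genPairs` (`#genPairs ≥ |P| (q − 1)(q − 2)`).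
* `no_three_lines_in_plane`, `ncard_lineSetIn_plane_le_two` — **no affine `2`-plane contains
  three distinct lines of `L`** (any field with `char ≠ 2`): the Wolff axiom for `k = 2` with the
  sharp absolute constant `2` (Tao's proof gives `O(|F|)`).
* `ncard_lineSetIn_le` — **every affine `3`-space `x₀ + U` (`finrank K U = 3`) contains at most
  `8 q` lines of `L`**: Tao's "`O(|F|)` lines in `λ`" with an explicit constant, in particular the
  Wolff axiom for `k = 3` (where `O(|F|²)` would suffice); `wolffAxiom` — both clauses of
  Definition 1.1 for `n = 4`.
* The tools, all proved here: `card_mul_ncard_level_le` (Lemma 3.1, (3–1), as a slab count: if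
  `A ⊆ V` is invariant under translation by a vector `e` with `⟨e, e⟩ ≠ 0` then
  `q · |A ∩ {Q = c}| ≤ 2 |A|`, because on each line `a + K e` the form takes the value `c` at most
  twice, `ncard_line_level_le_two`), whence `ncard_sphere_le`, `ncard_translate_inter_sphere_le`,
  `ncard_level_le`, `ncard_null_le`, `ncard_null_le'` (`≤ 2q²` vectors of given length in a
  `3`-space, `≤ 2q³` null vectors in `V`); `natCard_level_eq_sum` (slicing a level set along the
  orthogonal splitting `V = K u ⊕ u^⊥`, `bijective_decomp`); `card_le_ncard_conic_add_two` (a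
  conic `a s² + b t² = e` with `a b e ≠ 0` over `𝔽_q`, `q` odd, has at least `q − 2` points);
  `card_le_natCard_level_two`, `sq_le_natCard_level_three`, `mul_le_natCard_null_three` (Lemma
  3.1, (3–2), lower halves in ranks `2` and `3`: `≥ q − 2` vectors of each nonzero length on a
  nondegenerate plane, `≥ (q − 2)²` of each length and `≥ (q − 1)(q − 2)` nonzero null vectors
  in a nondegenerate `3`-space); and the key linear-algebra fact
  `apply_self_eq_zero_of_isotropic_plane`: in a nondegenerate `4`-space a vector orthogonal to a
  totally isotropic `2`-plane is null (the plane is its own orthogonal complement, by Mathlib's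
  `LinearMap.BilinForm.finrank_orthogonal`).

## Proof architecture (and where it departs from the paper)

Upper bounds follow the paper (Lemma 3.1 (3–1) = `card_mul_ncard_level_le`; pairs `(x, v)`
fibred over the null vector `v`, `ncard_genPairs_le`).  For the lower bounds Tao uses Gauss sums
(3–2); here the level sets are sliced along orthogonal splittings `V = K u ⊕ u^⊥` (Mathlib's
`LinearMap.BilinForm.restrict_nondegenerate_orthogonal_spanSingleton` keeps the complement
nondegenerate) down to binary diagonal forms `a s² + b t²`, whose level sets are counted by the
secant method from one point supplied by `FiniteField.exists_root_sum_quadratic`; and the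
generating pairs are fibred over the point `x ∈ P` (whose orthogonal complement `x^⊥` is a
nondegenerate `3`-space) rather than over the null direction.  The constants are therefore
explicit but not sharp.  For the Wolff axiom Tao counts the pairs generating a line inside `λ`;
here incidences `(p, ℓ)`, `p ∈ ℓ ⊆ λ = x₀ + U`, are double counted instead (`incidenceEquivIn`,
`natCard_incidence`): through a point `p ∈ P ∩ λ` pass at most two lines of `L` inside `λ` unless
`U ⊆ p^⊥` (`ncard_linesThroughIn_le_two`: three null directions in the plane `U ∩ p^⊥` would make
it totally isotropic and orthogonal to the unit vector `p`), at most two points of `P ∩ λ` are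
exceptional (`no_three_bad`: they lie on the line `U^⊥`) and through each of them pass at most
`2q²` lines (`ncard_linesThroughIn_le`), while `|P ∩ λ| ≤ 2q²`; hence `q · #lines ≤ 8 q²`.  The
plane statement is proved directly in its sharp form by the same mechanism
(`no_three_lines_in_plane`): two coplanar lines of `L` with non-proportional directions meet
(`exists_mem_inter_of_nonparallel`), and a common point of two lines of `L` with orthogonal null
directions would be a unit vector orthogonal to a totally isotropic plane (`false_of_mem_inter`);
parallel lines are handled by `parallel_frame`.

## Not in this file

* Sharp constants and the exact counts, which depend on the isometry class of `B` (for the split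
  class see `Tao2005Quadric`: `|P| = q (q² − 1)`, `|L| = (q − 1)(q + 1)²`, `q + 1` lines of `L`
  through each point, at most `2 (q + 1)` lines in a `3`-space).  They are proved for every
  nondegenerate symmetric form in the companion files
  `Literature.Combinatorics.Kakeya.Tao2005UnitSphereCounts` (`prop13_exact`: `|P| = q³ ∓ q`,
  `|L| · q = |P| · (q + 1)`, `q + 1` lines of `L` through each point) and
  `Literature.Combinatorics.Kakeya.Tao2005UnitSphereSections` (`prop13_sharp`: at most `q² + q`
  points of `P` and at most `2 (q + 1)` lines of `L` in every affine `3`-space).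
* Tao's remark that the lines of `L` do not all point in different directions (proved for the
  split form, `Tao2005Quadric.not_pointInDifferentDirections`).
* The real version ("a similar counterexample can be created in `ℝ⁴` as long as one chooses the
  form `⟨ , ⟩` to be indefinite", p. 338).

## References
* [Tao2005FiniteFieldBesicovitch4D] T. Tao, Pacific J. Math. 222 (2005), no. 2, 337–363 —
  Def. 1.1 and Prop. 1.3 (§1, p. 338), Lemma 3.1 and the proof of Prop. 1.3 (§3, pp. 340–342);
  arXiv:math/0204251 numbers them Def. 1 / Prop. 3 / Lemma 5.
-/

namespace Literature.Combinatorics.Kakeya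

namespace Tao2005UnitSphere

open Module

variable {K : Type*} [Field K] {V : Type*} [AddCommGroup V] [Module K V]

section Lines

variable (K) in
/-- The affine line `{x + t v : t ∈ K}` through `x` with direction vector `v` (the point `{x}` if
`v = 0`); Tao, §2: "a line in `F⁴` is a set of the form `l = {x + tv : t ∈ F}` where `x, v ∈ F⁴`
and `v` is nonzero". [folklore] -/
def line (x v : V) : Set V := Set.range fun t : K => x + t • v

/-- Membership in a line. [folklore] -/
theorem mem_line_iff {x v y : V} : y ∈ line K x v ↔ ∃ t : K, x + t • v = y := Iff.rfl

/-- The base point lies on the line. [folklore] -/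
theorem mem_line_self (x v : V) : x ∈ line K x v := ⟨0, by simp⟩

/-- The points `x + t v` lie on the line. [folklore] -/
theorem add_smul_mem_line (x v : V) (t : K) : x + t • v ∈ line K x v := ⟨t, rfl⟩

/-- The point `x + v` lies on the line. [folklore] -/
theorem add_mem_line (x v : V) : x + v ∈ line K x v := ⟨1, by simp⟩

/-- Re-basing a line at any of its points. [folklore] -/
theorem line_eq_of_mem {x v y : V} (hy : y ∈ line K x v) : line K y v = line K x v := by
  obtain ⟨s, rfl⟩ := hy
  ext z
  constructor
  · rintro ⟨t, rfl⟩
    exact ⟨s + t, by simp only [add_smul, add_assoc]⟩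
  · rintro ⟨t, rfl⟩
    exact ⟨t - s, by simp only [sub_smul]; abel⟩

/-- Rescaling the direction vector does not change the line. [folklore] -/
theorem line_smul (x v : V) {c : K} (hc : c ≠ 0) : line K x (c • v) = line K x v := by
  ext z
  constructor
  · rintro ⟨t, rfl⟩
    exact ⟨t * c, by simp only [mul_smul]⟩
  · rintro ⟨t, rfl⟩
    exact ⟨t / c, by simp only [smul_smul, div_mul_cancel₀ t hc]⟩

/-- Two direction vectors of the same line through the same point are proportional. [folklore] -/
theorem exists_eq_smul_of_line_eq {x v w : V} (hw : w ≠ 0) (h : line K x v = line K x w) :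
    ∃ c : K, c ≠ 0 ∧ w = c • v := by
  have hmem : x + w ∈ line K x v := by rw [h]; exact add_mem_line x w
  obtain ⟨c, hc⟩ := hmem
  have hcw : c • v = w := add_left_cancel hc
  refine ⟨c, ?_, hcw.symm⟩
  rintro rfl
  rw [zero_smul] at hcw
  exact hw hcw.symm

/-- A line with nonzero direction vector is parametrised injectively by `K`. [folklore] -/
theorem line_injective (x : V) {v : V} (hv : v ≠ 0) :
    Function.Injective fun t : K => x + t • v := by
  intro t s h
  have h' : (t - s) • v = 0 := by
    rw [sub_smul]
    exact sub_eq_zero.2 (add_left_cancel h)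
  rcases smul_eq_zero.1 h' with h'' | h''
  · exact sub_eq_zero.1 h''
  · exact absurd h'' hv

/-- A line with nonzero direction vector has `|K|` points. [folklore] -/
theorem natCard_line (x : V) {v : V} (hv : v ≠ 0) : Nat.card (line K x v) = Nat.card K :=
  (Nat.card_congr (Equiv.ofInjective _ (line_injective x hv))).symm

/-- The affine subspace `x + W` — "a translate of a vector subspace of `Fⁿ`" (Tao, Def. 1.1).
[folklore] -/
def translate (x : V) (W : Submodule K V) : Set V := {y | y - x ∈ W}

/-- Membership in a translate. [folklore] -/
theorem mem_translate_iff {x : V} {W : Submodule K V} {y : V} :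
    y ∈ translate x W ↔ y - x ∈ W := Iff.rfl

/-- `x ∈ x + W`. [folklore] -/
theorem self_mem_translate (x : V) (W : Submodule K V) : x ∈ translate x W := by
  simp [translate]

/-- Re-basing a translate at any of its points. [folklore] -/
theorem translate_eq_of_mem {x y : V} {W : Submodule K V} (hy : y ∈ translate x W) :
    translate y W = translate x W := by
  ext z
  simp only [mem_translate_iff] at hy ⊢
  constructor
  · intro h
    have h' := W.add_mem h hy
    rwa [sub_add_sub_cancel] at h'
  · intro h
    have h' := W.sub_mem h hy
    rwa [sub_sub_sub_cancel_right] at h'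

/-- The direction vector of a line contained in `x₀ + W` lies in `W`. [folklore] -/
theorem mem_of_line_subset {x₀ x v : V} {W : Submodule K V}
    (h : line K x v ⊆ translate x₀ W) : v ∈ W := by
  have h1 : x + v - x₀ ∈ W := h (add_mem_line x v)
  have h0 : x - x₀ ∈ W := h (mem_line_self x v)
  have h2 := W.sub_mem h1 h0
  have e : x + v - x₀ - (x - x₀) = v := by abel
  rwa [e] at h2

/-- A line through a point of `x₀ + W` with direction in `W` lies in `x₀ + W`. [folklore] -/
theorem line_subset_translate {x₀ x v : V} {W : Submodule K V} (hx : x ∈ translate x₀ W)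
    (hv : v ∈ W) : line K x v ⊆ translate x₀ W := by
  rintro _ ⟨t, rfl⟩
  rw [mem_translate_iff] at hx ⊢
  have e : x + t • v - x₀ = (x - x₀) + t • v := by abel
  rw [e]
  exact W.add_mem hx (W.smul_mem t hv)

/-- `x₀ + W` has as many points as `W`. [folklore] -/
def translateEquiv (x₀ : V) (W : Submodule K V) : translate x₀ W ≃ W where
  toFun y := ⟨y.1 - x₀, y.2⟩
  invFun w := ⟨w.1 + x₀, by simp [mem_translate_iff]⟩
  left_inv y := by simp
  right_inv w := by simp

/-- `|x₀ + W| = |W|`. [folklore] -/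
theorem natCard_translate (x₀ : V) (W : Submodule K V) :
    Nat.card (translate x₀ W) = Nat.card W :=
  Nat.card_congr (translateEquiv x₀ W)

end Lines

section Form

variable (B : LinearMap.BilinForm K V)

/-- Tao's "unit sphere" `P := {x ∈ F⁴ : ⟨x, x⟩ = 1}` of the form `B = ⟨ , ⟩` (eq. (1–1)).
[cite: Tao2005FiniteFieldBesicovitch4D, Prop. 1.3 (§1, p. 338)] -/
def sphere : Set V := {x | B x x = 1}

/-- Tao's family `L`: "the set of all lines of the form `{x + tv : t ∈ F}`, where `x ∈ F⁴`,
`v ∈ F⁴ ∖ {0}` are such that `⟨x, x⟩ = 1`, `⟨v, x⟩ = 0`, and `⟨v, v⟩ = 0`".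
[cite: Tao2005FiniteFieldBesicovitch4D, Prop. 1.3 (§1, p. 338)] -/
def lineSet : Set (Set V) :=
  {ℓ | ∃ x v : V, v ≠ 0 ∧ B x x = 1 ∧ B v x = 0 ∧ B v v = 0 ∧ ℓ = line K x v}

/-- The lines of `L` contained in a set `S`. [folklore] -/
def lineSetIn (S : Set V) : Set (Set V) := {ℓ | ℓ ∈ lineSet B ∧ ℓ ⊆ S}

/-- The lines of `L` contained in `S` and passing through `p`. [folklore] -/
def linesThroughIn (p : V) (S : Set V) : Set (Set V) := {ℓ | ℓ ∈ lineSet B ∧ ℓ ⊆ S ∧ p ∈ ℓ}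

variable {B}

/-- Membership in the sphere. [folklore] -/
theorem mem_sphere_iff {x : V} : x ∈ sphere B ↔ B x x = 1 := Iff.rfl

/-- A non-null vector is nonzero. [folklore] -/
theorem ne_zero_of_apply_self_ne_zero {u : V} (hu : B u u ≠ 0) : u ≠ 0 := fun h0 =>
  hu (by rw [h0, map_zero])

/-- Expansion of `⟨x + t v, x + t v⟩`. [folklore] -/
theorem apply_add_smul_self (x v : V) (t : K) :
    B (x + t • v) (x + t • v) = B x x + t * B x v + t * B v x + t * t * B v v := by
  simp only [map_add, map_smul, LinearMap.add_apply, LinearMap.smul_apply, smul_eq_mul]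
  ring

/-- Expansion of `⟨a u + b w, a u + b w⟩`. [folklore] -/
theorem apply_smul_add_smul_self (u w : V) (a b : K) :
    B (a • u + b • w) (a • u + b • w) =
      a * a * B u u + a * b * B u w + b * a * B w u + b * b * B w w := by
  simp only [map_add, map_smul, LinearMap.add_apply, LinearMap.smul_apply, smul_eq_mul]
  ring

/-- **"`P` … contains all the lines in `L`"** (symmetric `B`, any field).
[cite: Tao2005FiniteFieldBesicovitch4D, Prop. 1.3 (§1, p. 338)] -/
theorem subset_sphere_of_mem_lineSet (hBs : B.IsSymm) {ℓ : Set V} (hℓ : ℓ ∈ lineSet B) :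
    ℓ ⊆ sphere B := by
  obtain ⟨x, v, -, hx, hvx, hvv, rfl⟩ := hℓ
  rintro _ ⟨t, rfl⟩
  rw [mem_sphere_iff, apply_add_smul_self, hBs.eq x v, hvx, hvv, hx]
  ring

/-- **The lines contained in the sphere** (`char K ≠ 2`, `|K| ≥ 3`, symmetric `B`): the line
`{x + t v}` lies in `P` iff `⟨x, x⟩ = 1`, `⟨v, x⟩ = 0` and `⟨v, v⟩ = 0`; so `L` is the set of *all*
lines contained in `P`. [cite: Tao2005FiniteFieldBesicovitch4D, Prop. 1.3 (§1, p. 338)] -/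
theorem line_subset_sphere_iff (hBs : B.IsSymm) (h2 : (2 : K) ≠ 0)
    (h3 : ∃ c : K, c ≠ 0 ∧ c ≠ 1) (x v : V) :
    line K x v ⊆ sphere B ↔ B x x = 1 ∧ B v x = 0 ∧ B v v = 0 := by
  constructor
  · intro h
    have e : ∀ t : K, B x x + t * B x v + t * B v x + t * t * B v v = 1 := fun t => by
      rw [← apply_add_smul_self]
      exact h (add_smul_mem_line x v t)
    obtain ⟨c, hc0, hc1⟩ := h3
    have e0 := e 0
    have e1 := e 1
    have ec := e c
    rw [hBs.eq x v] at e1 ec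
    simp only [zero_mul, add_zero] at e0
    have hvv : c * (c - 1) * B v v = 0 := by linear_combination ec - c * e1 + (c - 1) * e0
    have hvv' : B v v = 0 := by
      rcases mul_eq_zero.1 hvv with h' | h'
      · rcases mul_eq_zero.1 h' with h'' | h''
        · exact absurd h'' hc0
        · exact absurd (sub_eq_zero.1 h'') hc1
      · exact h'
    have hvx : 2 * B v x = 0 := by linear_combination e1 - e0 - hvv'
    refine ⟨e0, ?_, hvv'⟩
    rcases mul_eq_zero.1 hvx with h' | h'
    · exact absurd h' h2
    · exact h'
  · rintro ⟨hx, hvx, hvv⟩ _ ⟨t, rfl⟩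
    rw [mem_sphere_iff, apply_add_smul_self, hBs.eq x v, hvx, hvv, hx]
    ring

/-- `lineSet B` consists exactly of the lines with nonzero direction contained in the sphere
(`char K ≠ 2`, `|K| ≥ 3`). [cite: Tao2005FiniteFieldBesicovitch4D, Prop. 1.3 (§1, p. 338)] -/
theorem mem_lineSet_iff (hBs : B.IsSymm) (h2 : (2 : K) ≠ 0) (h3 : ∃ c : K, c ≠ 0 ∧ c ≠ 1)
    (ℓ : Set V) : ℓ ∈ lineSet B ↔ ∃ x v : V, v ≠ 0 ∧ line K x v ⊆ sphere B ∧ ℓ = line K x v := by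
  constructor
  · rintro ⟨x, v, hv, hx, hvx, hvv, rfl⟩
    exact ⟨x, v, hv, (line_subset_sphere_iff hBs h2 h3 x v).2 ⟨hx, hvx, hvv⟩, rfl⟩
  · rintro ⟨x, v, hv, h, rfl⟩
    obtain ⟨hx, hvx, hvv⟩ := (line_subset_sphere_iff hBs h2 h3 x v).1 h
    exact ⟨x, v, hv, hx, hvx, hvv, rfl⟩

/-- Re-basing a line of `L` at any of its points: if `p ∈ ℓ ∈ L` then `ℓ = {p + t v}` with
`v ≠ 0`, `⟨v, p⟩ = 0`, `⟨v, v⟩ = 0` (and `⟨p, p⟩ = 1`). [folklore] -/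
theorem exists_eq_line_of_mem {ℓ : Set V} (hℓ : ℓ ∈ lineSet B) {p : V}
    (hp : p ∈ ℓ) : ∃ v : V, v ≠ 0 ∧ B v p = 0 ∧ B v v = 0 ∧ ℓ = line K p v := by
  obtain ⟨x, v, hv, -, hvx, hvv, rfl⟩ := hℓ
  obtain ⟨s, rfl⟩ := hp
  refine ⟨v, hv, ?_, hvv, (line_eq_of_mem (add_smul_mem_line x v s)).symm⟩
  simp only [map_add, map_smul, smul_eq_mul, hvx, hvv, mul_zero, add_zero]

/-- Every point of a line of `L` lies on the sphere. [folklore] -/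
theorem apply_self_eq_one_of_mem (hBs : B.IsSymm) {ℓ : Set V} (hℓ : ℓ ∈ lineSet B) {p : V}
    (hp : p ∈ ℓ) : B p p = 1 :=
  subset_sphere_of_mem_lineSet hBs hℓ hp

/-- Three pairwise non-proportional null vectors in the span of two of them force the two to be
orthogonal (`char K ≠ 2`): `⟨a v₁ + b v₂, a v₁ + b v₂⟩ = 2ab ⟨v₁, v₂⟩`. [folklore] -/
theorem apply_eq_zero_of_three_null (hBs : B.IsSymm) (h2 : (2 : K) ≠ 0) {v₁ v₂ : V} {a b : K}
    (h₁ : B v₁ v₁ = 0) (h₂' : B v₂ v₂ = 0) (ha : a ≠ 0) (hb : b ≠ 0)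
    (h₃ : B (a • v₁ + b • v₂) (a • v₁ + b • v₂) = 0) : B v₁ v₂ = 0 := by
  rw [apply_smul_add_smul_self, h₁, h₂', hBs.eq v₂ v₁] at h₃
  have h' : 2 * a * b * B v₁ v₂ = 0 := by linear_combination h₃
  simpa [h2, ha, hb] using h'

/-- The span of two mutually orthogonal null vectors is totally isotropic. [folklore] -/
theorem isotropic_span_pair (hBs : B.IsSymm) {v₁ v₂ : V} (h₁ : B v₁ v₁ = 0) (h₂' : B v₂ v₂ = 0)
    (h₁₂ : B v₁ v₂ = 0) :
    ∀ u ∈ Submodule.span K ({v₁, v₂} : Set V), ∀ w ∈ Submodule.span K ({v₁, v₂} : Set V),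
      B u w = 0 := by
  intro u hu w hw
  obtain ⟨a, b, rfl⟩ := Submodule.mem_span_pair.1 hu
  obtain ⟨c, d, rfl⟩ := Submodule.mem_span_pair.1 hw
  have h₂₁ : B v₂ v₁ = 0 := by rw [hBs.eq v₂ v₁]; exact h₁₂
  simp [h₁, h₂', h₁₂, h₂₁]

/-- Polarisation (`char K ≠ 2`): a subspace on which `⟨e, e⟩` vanishes identically is totally
isotropic. [folklore] -/
theorem isotropic_of_apply_self_eq_zero (hBs : B.IsSymm) (h2 : (2 : K) ≠ 0) {U : Submodule K V}
    (h : ∀ e ∈ U, B e e = 0) : ∀ u ∈ U, ∀ w ∈ U, B u w = 0 := by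
  intro u hu w hw
  have huw := h (u + w) (U.add_mem hu hw)
  simp only [map_add, LinearMap.add_apply, h u hu, h w hw, hBs.eq w u, zero_add, add_zero] at huw
  have h' : 2 * B u w = 0 := by linear_combination huw
  simpa [h2] using h'

end Form

section Rank

variable [FiniteDimensional K V] {B : LinearMap.BilinForm K V}

/-- **Key lemma.** In a nondegenerate `4`-space, a vector orthogonal to a totally isotropic
`2`-plane is itself a null vector (the plane is its own orthogonal complement). [folklore] -/
theorem apply_self_eq_zero_of_isotropic_plane (hB : B.Nondegenerate) (h4 : finrank K V = 4)
    {W : Submodule K V} (hW : finrank K W = 2) (hW0 : ∀ u ∈ W, ∀ w ∈ W, B u w = 0) {p : V}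
    (hp : ∀ w ∈ W, B w p = 0) : B p p = 0 := by
  have hle : W ≤ B.orthogonal W := fun w hw =>
    LinearMap.BilinForm.mem_orthogonal_iff.2 fun u hu => hW0 u hu w hw
  have hfin : finrank K (B.orthogonal W) = 2 := by
    rw [LinearMap.BilinForm.finrank_orthogonal hB, h4, hW]
  have heq : W = B.orthogonal W := Submodule.eq_of_le_of_finrank_eq hle (by rw [hW, hfin])
  have hpW : p ∈ B.orthogonal W := LinearMap.BilinForm.mem_orthogonal_iff.2 hp
  rw [← heq] at hpW
  exact hW0 p hpW p hpW

/-- A subspace of more than half the dimension carries a non-null vector (`B` nondegenerate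
symmetric, `char K ≠ 2`). [folklore] -/
theorem exists_apply_self_ne_zero (hB : B.Nondegenerate) (hBs : B.IsSymm) (h2 : (2 : K) ≠ 0)
    {U : Submodule K V} (hU : finrank K V < 2 * finrank K U) : ∃ e ∈ U, B e e ≠ 0 := by
  by_contra h
  push Not at h
  have h0 := isotropic_of_apply_self_eq_zero hBs h2 h
  have hle : U ≤ B.orthogonal U := fun w hw =>
    LinearMap.BilinForm.mem_orthogonal_iff.2 fun u hu => h0 u hu w hw
  have hmono := Submodule.finrank_mono hle
  rw [LinearMap.BilinForm.finrank_orthogonal hB] at hmono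
  omega

omit [FiniteDimensional K V] in
/-- `finrank (span {v₁, v₂}) ≤ 2`. [folklore] -/
theorem finrank_span_pair_le (v₁ v₂ : V) :
    finrank K (Submodule.span K ({v₁, v₂} : Set V)) ≤ 2 := by
  classical
  have h := finrank_span_finset_le_card (R := K) ({v₁, v₂} : Finset V)
  rw [Finset.coe_pair] at h
  exact h.trans Finset.card_le_two

/-- Two non-proportional vectors span a `2`-plane. [folklore] -/
theorem finrank_span_pair_eq_two {v₁ v₂ : V} (hv₁ : v₁ ≠ 0) (h : ∀ c : K, v₂ ≠ c • v₁) :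
    finrank K (Submodule.span K ({v₁, v₂} : Set V)) = 2 := by
  apply le_antisymm (finrank_span_pair_le v₁ v₂)
  have hlt : (K ∙ v₁) < Submodule.span K ({v₁, v₂} : Set V) := by
    refine lt_of_le_of_ne (Submodule.span_mono (by simp)) ?_
    intro heq
    have hv₂ : v₂ ∈ K ∙ v₁ := by rw [heq]; exact Submodule.subset_span (by simp)
    obtain ⟨c, hc⟩ := Submodule.mem_span_singleton.1 hv₂
    exact h c hc.symm
  have h1 : finrank K (K ∙ v₁) = 1 := finrank_span_singleton hv₁
  have h' := Submodule.finrank_lt_finrank_of_lt hlt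
  omega

/-- Two non-proportional vectors of a subspace of dimension `≤ 2` span it. [folklore] -/
theorem span_pair_eq_of_finrank_le_two {W : Submodule K V} (hW : finrank K W ≤ 2) {v₁ v₂ : V}
    (h₁ : v₁ ∈ W) (h₂' : v₂ ∈ W) (hv₁ : v₁ ≠ 0) (h : ∀ c : K, v₂ ≠ c • v₁) :
    Submodule.span K ({v₁, v₂} : Set V) = W ∧ finrank K W = 2 := by
  have hle : Submodule.span K ({v₁, v₂} : Set V) ≤ W :=
    Submodule.span_le.2 (Set.insert_subset_iff.2 ⟨h₁, Set.singleton_subset_iff.2 h₂'⟩)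
  have h2' := finrank_span_pair_eq_two hv₁ h
  have hmono := Submodule.finrank_mono hle
  have hW2 : finrank K W = 2 := by omega
  exact ⟨Submodule.eq_of_le_of_finrank_eq hle (by rw [h2', hW2]), hW2⟩

end Rank

section Count

/-- Fibre bound: if every fibre of `f` on `s` has at most `n` elements then
`|s| ≤ n · |f '' s|`. [folklore] -/
theorem ncard_le_mul_ncard_image {α β : Type*} [Finite α] (s : Set α) (f : α → β) (n : ℕ)
    (h : ∀ b, {a ∈ s | f a = b}.ncard ≤ n) : s.ncard ≤ n * (f '' s).ncard := by
  classical
  haveI := Fintype.ofFinite α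
  have h2 : f '' s = ↑(s.toFinset.image f) := by rw [Finset.coe_image, Set.coe_toFinset]
  rw [h2, Set.ncard_coe_finset, Set.ncard_eq_toFinset_card' s]
  refine Finset.card_le_mul_card_image s.toFinset n (fun b _ => ?_)
  have h3 : ({a ∈ s | f a = b} : Set α) = ↑(s.toFinset.filter (fun a => f a = b)) := by
    ext a
    simp
  have h4 := h b
  rwa [h3, Set.ncard_coe_finset] at h4

/-- A quadratic equation `α t² + β t + γ = 0` with `α ≠ 0` has at most two roots. [folklore] -/
theorem ncard_quadratic_le_two {α β γ : K} (hα : α ≠ 0) :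
    {t : K | α * t ^ 2 + β * t + γ = 0}.ncard ≤ 2 := by
  classical
  set p : Polynomial K :=
    Polynomial.C α * Polynomial.X ^ 2 + Polynomial.C β * Polynomial.X + Polynomial.C γ with hp
  have hdeg : p.natDegree = 2 := by rw [hp]; exact Polynomial.natDegree_quadratic hα
  have hp0 : p ≠ 0 := by
    intro h
    rw [h, Polynomial.natDegree_zero] at hdeg
    exact absurd hdeg (by norm_num)
  have hsub : {t : K | α * t ^ 2 + β * t + γ = 0} ⊆ ↑p.roots.toFinset := by
    intro t ht
    simp only [Set.mem_setOf_eq] at ht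
    rw [Finset.mem_coe, Multiset.mem_toFinset, Polynomial.mem_roots hp0, Polynomial.IsRoot.def, hp]
    simpa using ht
  calc {t : K | α * t ^ 2 + β * t + γ = 0}.ncard
      ≤ (↑p.roots.toFinset : Set K).ncard := Set.ncard_le_ncard hsub (Finset.finite_toSet _)
    _ = p.roots.toFinset.card := Set.ncard_coe_finset _
    _ ≤ Multiset.card p.roots := Multiset.toFinset_card_le _
    _ ≤ p.natDegree := Polynomial.card_roots' p
    _ = 2 := hdeg

variable {B : LinearMap.BilinForm K V}

/-- On a line `{a + t e}` with `⟨e, e⟩ ≠ 0` the quadratic form takes each value at most twice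
(Tao's Lemma 3.1, (3–1), in the form used here). [cite: Tao2005FiniteFieldBesicovitch4D, Lemma 3.1]
-/
theorem ncard_line_level_le_two {e : V} (he : B e e ≠ 0) (a : V) (c : K) :
    {t : K | B (a + t • e) (a + t • e) = c}.ncard ≤ 2 := by
  have hset : {t : K | B (a + t • e) (a + t • e) = c} =
      {t : K | B e e * t ^ 2 + (B a e + B e a) * t + (B a a - c) = 0} := by
    ext t
    simp only [Set.mem_setOf_eq, apply_add_smul_self]
    constructor <;> intro h <;> linear_combination h
  rw [hset]
  exact ncard_quadratic_le_two he

/-- **Slab count** (Tao's Lemma 3.1, (3–1): `|{Q = c}| ≲ |F|^{n−1}`, in the form used here).  If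
`A ⊆ V` is invariant under translation by a vector `e` with `⟨e, e⟩ ≠ 0`, then
`q · |A ∩ {x : ⟨x, x⟩ = c}| ≤ 2 |A|`: on each line `a + K e ⊆ A` the form takes the value `c` at
most twice. [cite: Tao2005FiniteFieldBesicovitch4D, Lemma 3.1] -/
theorem card_mul_ncard_level_le [Finite K] [Finite V] {A : Set V} {e : V}
    (hA : ∀ a ∈ A, ∀ t : K, a + t • e ∈ A) (he : B e e ≠ 0) (c : K) :
    Nat.card K * (A ∩ {x | B x x = c}).ncard ≤ 2 * A.ncard := by
  classical
  let T : Set (V × K) := {z | z.1 ∈ A ∧ B (z.1 + z.2 • e) (z.1 + z.2 • e) = c}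
  have eT : T ≃ (A ∩ {x | B x x = c} : Set V) × K :=
    { toFun := fun z => (⟨z.1.1 + z.1.2 • e, hA _ z.2.1 _, z.2.2⟩, z.1.2)
      invFun := fun y => ⟨(y.1.1 - y.2 • e, y.2), by
        refine ⟨?_, ?_⟩
        · have h' := hA _ y.1.2.1 (-y.2)
          rwa [neg_smul, ← sub_eq_add_neg] at h'
        · show B (y.1.1 - y.2 • e + y.2 • e) (y.1.1 - y.2 • e + y.2 • e) = c
          rw [sub_add_cancel]
          exact y.1.2.2⟩
      left_inv := fun z => by simp
      right_inv := fun y => by simp }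
  have hT : Nat.card T = (A ∩ {x | B x x = c}).ncard * Nat.card K := by
    rw [Nat.card_congr eT, Nat.card_prod, Nat.card_coe_set_eq]
  have hfib : T.ncard ≤ 2 * (Prod.fst '' T).ncard :=
    ncard_le_mul_ncard_image T Prod.fst 2 (fun a => by
      have hsub : {z ∈ T | z.1 = a} ⊆
          (fun t : K => (a, t)) '' {t | B (a + t • e) (a + t • e) = c} := by
        rintro ⟨a', t⟩ ⟨⟨-, ht⟩, ha'⟩
        simp only at ha'
        subst ha'
        exact ⟨t, by simpa using ht, rfl⟩
      exact (Set.ncard_le_ncard hsub (Set.toFinite _)).trans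
        ((Set.ncard_image_le (Set.toFinite _)).trans (ncard_line_level_le_two he a c)))
  have himg : (Prod.fst '' T).ncard ≤ A.ncard :=
    Set.ncard_le_ncard (by rintro _ ⟨z, hz, rfl⟩; exact hz.1) (Set.toFinite A)
  calc Nat.card K * (A ∩ {x | B x x = c}).ncard = Nat.card T := by rw [hT, mul_comm]
    _ = T.ncard := (Nat.card_coe_set_eq T)
    _ ≤ 2 * (Prod.fst '' T).ncard := hfib
    _ ≤ 2 * A.ncard := Nat.mul_le_mul_left 2 himg

variable [Finite K] [FiniteDimensional K V]

/-- **`|P| ≲ |F|³`, explicitly `|P| ≤ 2q³`** (`B` nondegenerate symmetric on a `4`-space over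
`𝔽_q`, `q` odd). [cite: Tao2005FiniteFieldBesicovitch4D, Prop. 1.3 (§1, p. 338)] -/
theorem ncard_sphere_le (hB : B.Nondegenerate) (hBs : B.IsSymm) (h2 : (2 : K) ≠ 0)
    (h4 : finrank K V = 4) : (sphere B).ncard ≤ 2 * Nat.card K ^ 3 := by
  have : Finite V := Module.finite_of_finite K
  obtain ⟨e, -, he⟩ := exists_apply_self_ne_zero hB hBs h2 (U := ⊤)
    (by rw [finrank_top, h4]; norm_num)
  have h := card_mul_ncard_level_le (B := B) (A := Set.univ) (fun a _ t => Set.mem_univ _) he 1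
  rw [Set.univ_inter, Set.ncard_univ, Module.natCard_eq_pow_finrank (K := K) (V := V), h4] at h
  have hq : 0 < Nat.card K := Nat.card_pos
  refine Nat.le_of_mul_le_mul_left ?_ hq
  calc Nat.card K * (sphere B).ncard = Nat.card K * ({x | B x x = 1} : Set V).ncard := rfl
    _ ≤ 2 * Nat.card K ^ 4 := h
    _ = Nat.card K * (2 * Nat.card K ^ 3) := by ring

/-- At most `2q²` points of `P` on any affine `3`-space `x₀ + U`.
[cite: Tao2005FiniteFieldBesicovitch4D, Prop. 1.3, proof (§3, p. 342)] -/
theorem ncard_translate_inter_sphere_le (hB : B.Nondegenerate) (hBs : B.IsSymm) (h2 : (2 : K) ≠ 0)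
    (h4 : finrank K V = 4) {U : Submodule K V} (hU : finrank K U = 3) (x₀ : V) :
    (translate x₀ U ∩ sphere B).ncard ≤ 2 * Nat.card K ^ 2 := by
  have : Finite V := Module.finite_of_finite K
  obtain ⟨e, heU, he⟩ := exists_apply_self_ne_zero hB hBs h2 (U := U) (by rw [h4, hU]; norm_num)
  have hA : ∀ a ∈ translate x₀ U, ∀ t : K, a + t • e ∈ translate x₀ U := fun a ha t => by
    rw [mem_translate_iff] at ha ⊢
    have e' : a + t • e - x₀ = (a - x₀) + t • e := by abel
    rw [e']
    exact U.add_mem ha (U.smul_mem t heU)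
  have h := card_mul_ncard_level_le (B := B) hA he 1
  rw [← Nat.card_coe_set_eq (translate x₀ U), natCard_translate,
    Module.natCard_eq_pow_finrank (K := K) (V := U), hU] at h
  have hq : 0 < Nat.card K := Nat.card_pos
  refine Nat.le_of_mul_le_mul_left ?_ hq
  calc Nat.card K * (translate x₀ U ∩ sphere B).ncard ≤ 2 * Nat.card K ^ 3 := h
    _ = Nat.card K * (2 * Nat.card K ^ 2) := by ring

/-- On a `3`-dimensional subspace `U` the form takes each value `c` at most `2q²` times (Tao's
Lemma 3.1 restricted to `U ≅ F³`: "there are `∼ |F|²` choices for `x`", p. 342; upper half).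
[cite: Tao2005FiniteFieldBesicovitch4D, Prop. 1.3, proof (§3, p. 342)] -/
theorem ncard_level_le (hB : B.Nondegenerate) (hBs : B.IsSymm) (h2 : (2 : K) ≠ 0)
    (h4 : finrank K V = 4) {U : Submodule K V} (hU : finrank K U = 3) (c : K) :
    {v : V | v ∈ U ∧ B v v = c}.ncard ≤ 2 * Nat.card K ^ 2 := by
  have : Finite V := Module.finite_of_finite K
  obtain ⟨e, heU, he⟩ := exists_apply_self_ne_zero hB hBs h2 (U := U) (by rw [h4, hU]; norm_num)
  have hA : ∀ a ∈ (U : Set V), ∀ t : K, a + t • e ∈ (U : Set V) := fun a ha t =>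
    U.add_mem ha (U.smul_mem t heU)
  have h := card_mul_ncard_level_le (B := B) hA he c
  rw [← Nat.card_coe_set_eq (U : Set V), SetLike.coe_sort_coe,
    Module.natCard_eq_pow_finrank (K := K) (V := U), hU] at h
  have hq : 0 < Nat.card K := Nat.card_pos
  refine Nat.le_of_mul_le_mul_left ?_ hq
  calc Nat.card K * {v : V | v ∈ U ∧ B v v = c}.ncard
      = Nat.card K * ((U : Set V) ∩ {x | B x x = c}).ncard := rfl
    _ ≤ 2 * Nat.card K ^ 3 := h
    _ = Nat.card K * (2 * Nat.card K ^ 2) := by ring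

/-- At most `2q²` null vectors in any `3`-dimensional subspace `U` (Tao: "By Lemma 3.1, the
number of null vectors `{v ∈ λ − x₀ : ⟨v, v⟩ = 0}` is `O(|F|²)`", p. 342).
[cite: Tao2005FiniteFieldBesicovitch4D, Prop. 1.3, proof (§3, p. 342)] -/
theorem ncard_null_le (hB : B.Nondegenerate) (hBs : B.IsSymm) (h2 : (2 : K) ≠ 0)
    (h4 : finrank K V = 4) {U : Submodule K V} (hU : finrank K U = 3) :
    {v : V | v ∈ U ∧ B v v = 0}.ncard ≤ 2 * Nat.card K ^ 2 :=
  ncard_level_le hB hBs h2 h4 hU 0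

/-- At most `2q³` null vectors in `V`: Tao's "`∼ |F|³` choices of null direction" (p. 342), upper
half. [cite: Tao2005FiniteFieldBesicovitch4D, Prop. 1.3, proof (§3, p. 342)] -/
theorem ncard_null_le' (hB : B.Nondegenerate) (hBs : B.IsSymm) (h2 : (2 : K) ≠ 0)
    (h4 : finrank K V = 4) : {v : V | B v v = 0}.ncard ≤ 2 * Nat.card K ^ 3 := by
  have : Finite V := Module.finite_of_finite K
  obtain ⟨e, -, he⟩ := exists_apply_self_ne_zero hB hBs h2 (U := ⊤)
    (by rw [finrank_top, h4]; norm_num)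
  have h := card_mul_ncard_level_le (B := B) (A := Set.univ) (fun a _ t => Set.mem_univ _) he 0
  rw [Set.univ_inter, Set.ncard_univ, Module.natCard_eq_pow_finrank (K := K) (V := V), h4] at h
  have hq : 0 < Nat.card K := Nat.card_pos
  refine Nat.le_of_mul_le_mul_left ?_ hq
  calc Nat.card K * {v : V | B v v = 0}.ncard ≤ 2 * Nat.card K ^ 4 := h
    _ = Nat.card K * (2 * Nat.card K ^ 3) := by ring

end Count

section Plane

variable [FiniteDimensional K V] {B : LinearMap.BilinForm K V}

/-- Two coplanar lines with non-proportional directions meet. [folklore] -/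
theorem exists_mem_inter_of_nonparallel {W : Submodule K V} (hW : finrank K W = 2)
    {x₀ x₁ v₁ x₂ v₂ : V}
    (h₁ : line K x₁ v₁ ⊆ translate x₀ W) (h₂ : line K x₂ v₂ ⊆ translate x₀ W) (hv₁ : v₁ ≠ 0)
    (h : ∀ c : K, v₂ ≠ c • v₁) : ∃ r : V, r ∈ line K x₁ v₁ ∧ r ∈ line K x₂ v₂ := by
  have hW' := (span_pair_eq_of_finrank_le_two hW.le (mem_of_line_subset h₁) (mem_of_line_subset h₂)
    hv₁ h).1
  have hx : x₂ - x₁ ∈ Submodule.span K ({v₁, v₂} : Set V) := by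
    rw [hW']
    have h1' : x₁ - x₀ ∈ W := h₁ (mem_line_self x₁ v₁)
    have h2' : x₂ - x₀ ∈ W := h₂ (mem_line_self x₂ v₂)
    have h3 := W.sub_mem h2' h1'
    rwa [sub_sub_sub_cancel_right] at h3
  obtain ⟨a, b, hab⟩ := Submodule.mem_span_pair.1 hx
  refine ⟨x₁ + a • v₁, add_smul_mem_line x₁ v₁ a, -b, ?_⟩
  show x₂ + (-b) • v₂ = x₁ + a • v₁
  rw [← sub_eq_zero]
  have e : x₂ + (-b) • v₂ - (x₁ + a • v₁) = (x₂ - x₁) - (a • v₁ + b • v₂) := by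
    rw [neg_smul]; abel
  rw [e, hab, sub_self]

/-- Two lines of `L` with non-proportional, mutually orthogonal directions cannot meet: the common
point would be a unit vector orthogonal to a totally isotropic plane. [folklore] -/
theorem false_of_mem_inter (hB : B.Nondegenerate) (hBs : B.IsSymm) (h4 : finrank K V = 4)
    {x₁ v₁ x₂ v₂ r : V} (hv₁ : v₁ ≠ 0) (h : ∀ c : K, v₂ ≠ c • v₁)
    (hx₁ : B x₁ x₁ = 1) (hv₁x : B v₁ x₁ = 0) (hv₁v : B v₁ v₁ = 0)
    (hv₂x : B v₂ x₂ = 0) (hv₂v : B v₂ v₂ = 0) (h₁₂ : B v₁ v₂ = 0)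
    (hr₁ : r ∈ line K x₁ v₁) (hr₂ : r ∈ line K x₂ v₂) : False := by
  obtain ⟨s, rfl⟩ := hr₁
  obtain ⟨t, ht⟩ := hr₂
  dsimp only at ht
  have hW2 := finrank_span_pair_eq_two hv₁ h
  have hiso := isotropic_span_pair hBs hv₁v hv₂v h₁₂
  have hperp : ∀ w ∈ Submodule.span K ({v₁, v₂} : Set V), B w (x₁ + s • v₁) = 0 := by
    intro w hw
    obtain ⟨a, b, rfl⟩ := Submodule.mem_span_pair.1 hw
    have e1 : B v₁ (x₁ + s • v₁) = 0 := by
      simp only [map_add, map_smul, smul_eq_mul, hv₁x, hv₁v, mul_zero, add_zero]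
    have e2 : B v₂ (x₁ + s • v₁) = 0 := by
      rw [← ht]
      simp only [map_add, map_smul, smul_eq_mul, hv₂x, hv₂v, mul_zero, add_zero]
    rw [LinearMap.map_add₂, LinearMap.map_smul₂, LinearMap.map_smul₂, e1, e2, smul_zero, smul_zero,
      add_zero]
  have h0 := apply_self_eq_zero_of_isotropic_plane hB h4 hW2 hiso hperp
  have h1 : B (x₁ + s • v₁) (x₁ + s • v₁) = 1 := by
    rw [apply_add_smul_self, hBs.eq x₁ v₁, hv₁x, hv₁v, hx₁]; ring
  rw [h0] at h1
  exact zero_ne_one h1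

/-- **Frame of two parallel lines of `L`.** If `{x₁ + t v₁} ≠ {x₂ + t v₂}` are lines of `L` in the
plane `x₀ + W` with `v₂ = c v₁`, then with `w = x₂ − x₁`: `W = span {v₁, w}`, `w` is not a multiple
of `v₁`, `⟨v₁, w⟩ = 0` and `2⟨x₁, w⟩ + ⟨w, w⟩ = 0`. [folklore] -/
theorem parallel_frame (hBs : B.IsSymm) {W : Submodule K V} (hW : finrank K W = 2)
    {x₀ x₁ v₁ x₂ v₂ : V}
    (h₁ : line K x₁ v₁ ⊆ translate x₀ W) (h₂ : line K x₂ v₂ ⊆ translate x₀ W) (hv₁ : v₁ ≠ 0)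
    (hv₂ : v₂ ≠ 0) {c : K} (hc : v₂ = c • v₁) (hne : line K x₁ v₁ ≠ line K x₂ v₂)
    (hx₁ : B x₁ x₁ = 1) (hv₁x : B v₁ x₁ = 0) (hx₂ : B x₂ x₂ = 1) (hv₂x : B v₂ x₂ = 0) :
    Submodule.span K ({v₁, x₂ - x₁} : Set V) = W ∧ (∀ d : K, x₂ - x₁ ≠ d • v₁) ∧
      B v₁ (x₂ - x₁) = 0 ∧ 2 * B x₁ (x₂ - x₁) + B (x₂ - x₁) (x₂ - x₁) = 0 := by
  have hc0 : c ≠ 0 := by rintro rfl; rw [zero_smul] at hc; exact hv₂ hc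
  have hnd : ∀ d : K, x₂ - x₁ ≠ d • v₁ := by
    intro d hd
    apply hne
    have hx₂mem : x₂ ∈ line K x₁ v₁ := ⟨d, by show x₁ + d • v₁ = x₂; rw [← hd]; abel⟩
    rw [hc, line_smul x₂ v₁ hc0, line_eq_of_mem hx₂mem]
  have hwW : x₂ - x₁ ∈ W := by
    have h1' : x₁ - x₀ ∈ W := h₁ (mem_line_self x₁ v₁)
    have h2' : x₂ - x₀ ∈ W := h₂ (mem_line_self x₂ v₂)
    have h3 := W.sub_mem h2' h1'
    rwa [sub_sub_sub_cancel_right] at h3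
  have hspan := (span_pair_eq_of_finrank_le_two hW.le (mem_of_line_subset h₁) hwW hv₁ hnd).1
  have hv₁x₂ : B v₁ x₂ = 0 := by
    have h' : c * B v₁ x₂ = 0 := by
      have h'' := hv₂x
      rw [hc, map_smul, LinearMap.smul_apply, smul_eq_mul] at h''
      exact h''
    rcases mul_eq_zero.1 h' with h'' | h''
    · exact absurd h'' hc0
    · exact h''
  have hvw : B v₁ (x₂ - x₁) = 0 := by rw [map_sub, hv₁x₂, hv₁x, sub_zero]
  refine ⟨hspan, hnd, hvw, ?_⟩
  have e : B x₂ x₂ = B x₁ x₁ + B x₁ (x₂ - x₁) + B (x₂ - x₁) x₁ + B (x₂ - x₁) (x₂ - x₁) := by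
    have hx : x₂ = x₁ + (x₂ - x₁) := by abel
    conv_lhs => rw [hx]
    simp only [map_add, LinearMap.add_apply]
    ring
  rw [hx₂, hx₁, hBs.eq (x₂ - x₁) x₁] at e
  linear_combination -e

omit [FiniteDimensional K V] in
/-- In the frame of `parallel_frame`, a null vector of `W` that is not a multiple of `v₁` forces
`⟨w, w⟩ = 0`, i.e. `W` totally isotropic. [folklore] -/
theorem apply_self_eq_zero_of_frame (hBs : B.IsSymm) {v₁ w u : V} (hv₁v : B v₁ v₁ = 0)
    (hvw : B v₁ w = 0)
    (hu : u ∈ Submodule.span K ({v₁, w} : Set V)) (hnd : ∀ d : K, u ≠ d • v₁) (huu : B u u = 0) :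
    B w w = 0 := by
  obtain ⟨a, b, rfl⟩ := Submodule.mem_span_pair.1 hu
  have hb : b ≠ 0 := by
    rintro rfl
    exact hnd a (by rw [zero_smul, add_zero])
  rw [apply_smul_add_smul_self, hv₁v, hvw, hBs.eq w v₁, hvw] at huu
  have h' : b * b * B w w = 0 := by linear_combination huu
  rcases mul_eq_zero.1 h' with h'' | h''
  · rcases mul_eq_zero.1 h'' with h₃ | h₃
    · exact absurd h₃ hb
    · exact absurd h₃ hb
  · exact h''

/-- **The Wolff axiom for `k = 2`, sharp form: no affine `2`-plane contains three distinct lines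
of `L`** (`B` nondegenerate symmetric on a `4`-space, `char K ≠ 2`; any field).  Tao proves
`O(|F|)` lines per plane (p. 342); the sharp statement is the classical fact that a plane meets a
quadric threefold containing no planes in a conic, i.e. in at most two lines.
[cite: Tao2005FiniteFieldBesicovitch4D, Prop. 1.3 (§1, p. 338)] -/
theorem no_three_lines_in_plane (hB : B.Nondegenerate) (hBs : B.IsSymm) (h2 : (2 : K) ≠ 0)
    (h4 : finrank K V = 4) {W : Submodule K V} (hW : finrank K W = 2) (x₀ : V)
    {ℓ₁ ℓ₂ ℓ₃ : Set V} (h₁ : ℓ₁ ∈ lineSetIn B (translate x₀ W))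
    (h₂' : ℓ₂ ∈ lineSetIn B (translate x₀ W)) (h₃ : ℓ₃ ∈ lineSetIn B (translate x₀ W))
    (h12 : ℓ₁ ≠ ℓ₂) (h13 : ℓ₁ ≠ ℓ₃) (h23 : ℓ₂ ≠ ℓ₃) : False := by
  obtain ⟨⟨x₁, v₁, hv₁, hx₁, hv₁x, hv₁v, rfl⟩, hs₁⟩ := h₁
  obtain ⟨⟨x₂, v₂, hv₂, hx₂, hv₂x, hv₂v, rfl⟩, hs₂⟩ := h₂'
  obtain ⟨⟨x₃, v₃, hv₃, hx₃, hv₃x, hv₃v, rfl⟩, hs₃⟩ := h₃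
  -- Step 1: two of the lines with non-proportional orthogonal directions give a contradiction.
  have meet : ∀ {y₁ u₁ y₂ u₂ : V}, line K y₁ u₁ ⊆ translate x₀ W → line K y₂ u₂ ⊆ translate x₀ W →
      u₁ ≠ 0 → (∀ c : K, u₂ ≠ c • u₁) → B y₁ y₁ = 1 → B u₁ y₁ = 0 → B u₁ u₁ = 0 →
      B u₂ y₂ = 0 → B u₂ u₂ = 0 → B u₁ u₂ = 0 → False := by
    intro y₁ u₁ y₂ u₂ hl₁ hl₂ hu₁ hnp hy₁ hu₁y hu₁u hu₂y hu₂u h₁₂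
    obtain ⟨r, hr₁, hr₂⟩ := exists_mem_inter_of_nonparallel hW hl₁ hl₂ hu₁ hnp
    exact false_of_mem_inter hB hBs h4 hu₁ hnp hy₁ hu₁y hu₁u hu₂y hu₂u h₁₂ hr₁ hr₂
  -- Step 2: a parallel pair plus a non-proportional null direction makes `W` totally isotropic.
  have iso_of_par : ∀ {y₁ u₁ y₂ u₂ u₃ : V} {c : K}, line K y₁ u₁ ⊆ translate x₀ W →
      line K y₂ u₂ ⊆ translate x₀ W → u₁ ≠ 0 → u₂ ≠ 0 → u₂ = c • u₁ →
      line K y₁ u₁ ≠ line K y₂ u₂ → B y₁ y₁ = 1 → B u₁ y₁ = 0 → B u₁ u₁ = 0 → B y₂ y₂ = 1 →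
      B u₂ y₂ = 0 → u₃ ∈ W → (∀ d : K, u₃ ≠ d • u₁) → B u₃ u₃ = 0 →
      ∀ u ∈ W, ∀ w ∈ W, B u w = 0 := by
    intro y₁ u₁ y₂ u₂ u₃ c hl₁ hl₂ hu₁ hu₂ hc hne hy₁ hu₁y hu₁u hy₂ hu₂y hu₃W hnd hu₃u
    obtain ⟨hspan, -, hvw, -⟩ :=
      parallel_frame hBs hW hl₁ hl₂ hu₁ hu₂ hc hne hy₁ hu₁y hy₂ hu₂y
    have hww := apply_self_eq_zero_of_frame hBs hu₁u hvw (hspan ▸ hu₃W) hnd hu₃u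
    rw [← hspan]
    exact isotropic_span_pair hBs hu₁u hww hvw
  by_cases p12 : ∃ c : K, v₂ = c • v₁
  · obtain ⟨c, hc⟩ := p12
    by_cases p13 : ∃ d : K, v₃ = d • v₁
    · -- three parallel lines
      obtain ⟨d, hd⟩ := p13
      obtain ⟨hspan, hnd₂, hvw₂, e₂⟩ :=
        parallel_frame hBs hW hs₁ hs₂ hv₁ hv₂ hc h12 hx₁ hv₁x hx₂ hv₂x
      obtain ⟨-, hnd₃, -, e₃⟩ :=
        parallel_frame hBs hW hs₁ hs₃ hv₁ hv₃ hd h13 hx₁ hv₁x hx₃ hv₃x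
      have hc0 : c ≠ 0 := by rintro rfl; rw [zero_smul] at hc; exact hv₂ hc
      obtain ⟨-, hnd₂₃, -, -⟩ :=
        parallel_frame hBs hW hs₂ hs₃ hv₂ hv₃ (c := d / c)
          (by rw [hd, hc, smul_smul, div_mul_cancel₀ d hc0]) h23 hx₂ hv₂x hx₃ hv₃x
      have hw₃W : x₃ - x₁ ∈ W := by
        have h1' : x₁ - x₀ ∈ W := hs₁ (mem_line_self x₁ v₁)
        have h3' : x₃ - x₀ ∈ W := hs₃ (mem_line_self x₃ v₃)
        have h' := W.sub_mem h3' h1'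
        rwa [sub_sub_sub_cancel_right] at h'
      rw [← hspan] at hw₃W
      obtain ⟨a, b, hab⟩ := Submodule.mem_span_pair.1 hw₃W
      have hb0 : b ≠ 0 := by
        rintro rfl
        exact hnd₃ a (by rw [← hab, zero_smul, add_zero])
      have hb1 : b ≠ 1 := by
        rintro rfl
        refine hnd₂₃ (a / c) ?_
        rw [hc, smul_smul, div_mul_cancel₀ a hc0]
        have e : x₃ - x₂ = (x₃ - x₁) - (x₂ - x₁) := by abel
        rw [e, ← hab, one_smul, add_sub_cancel_right]
      -- expand e₃ in the frame (v₁, w) with w = x₂ - x₁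
      set w := x₂ - x₁ with hw
      have hx₁v : B x₁ v₁ = 0 := by rw [hBs.eq x₁ v₁]; exact hv₁x
      have e₃' : 2 * (b * B x₁ w) + b * b * B w w = 0 := by
        have hBx : B x₁ (x₃ - x₁) = b * B x₁ w := by
          rw [← hab, map_add, map_smul, map_smul, smul_eq_mul, smul_eq_mul, hx₁v, mul_zero,
            zero_add]
        have hBw : B (x₃ - x₁) (x₃ - x₁) = b * b * B w w := by
          rw [← hab, apply_smul_add_smul_self, hv₁v, hvw₂, hBs.eq w v₁, hvw₂]; ring
        rw [hBx, hBw] at e₃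
        exact e₃
      have hww : B w w = 0 := by
        have h' : b * (b - 1) * B w w = 0 := by linear_combination e₃' - b * e₂
        rcases mul_eq_zero.1 h' with h'' | h''
        · rcases mul_eq_zero.1 h'' with h₃ | h₃
          · exact absurd h₃ hb0
          · exact absurd (sub_eq_zero.1 h₃) hb1
        · exact h''
      have hxw : B x₁ w = 0 := by
        have h' : 2 * B x₁ w = 0 := by linear_combination e₂ - hww
        rcases mul_eq_zero.1 h' with h'' | h''
        · exact absurd h'' h2
        · exact h''
      have hiso := isotropic_span_pair hBs hv₁v hww hvw₂
      have hperp : ∀ u ∈ Submodule.span K ({v₁, w} : Set V), B u x₁ = 0 := by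
        intro u hu
        obtain ⟨a', b', rfl⟩ := Submodule.mem_span_pair.1 hu
        rw [map_add, map_smul, map_smul, LinearMap.add_apply, LinearMap.smul_apply,
          LinearMap.smul_apply, smul_eq_mul, smul_eq_mul, hv₁x, hBs.eq w x₁, hxw, mul_zero,
          mul_zero, add_zero]
      have h0 := apply_self_eq_zero_of_isotropic_plane hB h4 (hspan.symm ▸ hW) hiso hperp
      rw [hx₁] at h0
      exact one_ne_zero h0
    · -- ℓ₁ ∥ ℓ₂, ℓ₃ not parallel to ℓ₁
      push Not at p13
      have hiso := iso_of_par hs₁ hs₂ hv₁ hv₂ hc h12 hx₁ hv₁x hv₁v hx₂ hv₂x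
        (mem_of_line_subset hs₃) p13 hv₃v
      exact meet hs₁ hs₃ hv₁ p13 hx₁ hv₁x hv₁v hv₃x hv₃v
        (hiso v₁ (mem_of_line_subset hs₁) v₃ (mem_of_line_subset hs₃))
  · push Not at p12
    -- v₁, v₂ non-proportional; find ⟨v₁, v₂⟩ = 0 from the third line
    have h₁₂ : B v₁ v₂ = 0 := by
      by_cases p13 : ∃ d : K, v₃ = d • v₁
      · obtain ⟨d, hd⟩ := p13
        have hiso := iso_of_par hs₁ hs₃ hv₁ hv₃ hd h13 hx₁ hv₁x hv₁v hx₃ hv₃x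
          (mem_of_line_subset hs₂) p12 hv₂v
        exact hiso v₁ (mem_of_line_subset hs₁) v₂ (mem_of_line_subset hs₂)
      · push Not at p13
        by_cases p23 : ∃ d : K, v₃ = d • v₂
        · obtain ⟨d, hd⟩ := p23
          have p21 : ∀ c : K, v₁ ≠ c • v₂ := by
            intro c' hc'
            have hc'0 : c' ≠ 0 := by rintro rfl; rw [zero_smul] at hc'; exact hv₁ hc'
            exact p12 c'⁻¹ (by rw [hc', smul_smul, inv_mul_cancel₀ hc'0, one_smul])
          have hiso := iso_of_par hs₂ hs₃ hv₂ hv₃ hd h23 hx₂ hv₂x hv₂v hx₃ hv₃x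
            (mem_of_line_subset hs₁) p21 hv₁v
          exact hiso v₁ (mem_of_line_subset hs₁) v₂ (mem_of_line_subset hs₂)
        · push Not at p23
          -- three pairwise non-proportional null directions in `W`
          have hspan := (span_pair_eq_of_finrank_le_two hW.le (mem_of_line_subset hs₁)
            (mem_of_line_subset hs₂) hv₁ p12).1
          have hv₃W : v₃ ∈ Submodule.span K ({v₁, v₂} : Set V) :=
            hspan.symm ▸ mem_of_line_subset hs₃
          obtain ⟨a, b, hab⟩ := Submodule.mem_span_pair.1 hv₃W
          have ha : a ≠ 0 := by
            rintro rfl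
            exact p23 b (by rw [← hab, zero_smul, zero_add])
          have hb : b ≠ 0 := by
            rintro rfl
            exact p13 a (by rw [← hab, zero_smul, add_zero])
          exact apply_eq_zero_of_three_null hBs h2 hv₁v hv₂v ha hb (hab.symm ▸ hv₃v)
    exact meet hs₁ hs₂ hv₁ p12 hx₁ hv₁x hv₁v hv₂x hv₂v h₁₂

/-- **The Wolff axiom for `k = 2`** (counted form, `K` finite): every affine `2`-plane `x₀ + W`
contains at most `2` lines of `L` — Tao's `O(|F|^{k−1}) = O(|F|)` with the sharp absolute
constant. [cite: Tao2005FiniteFieldBesicovitch4D, Prop. 1.3 (§1, p. 338)] -/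
theorem ncard_lineSetIn_plane_le_two [Finite K] (hB : B.Nondegenerate) (hBs : B.IsSymm)
    (h2 : (2 : K) ≠ 0) (h4 : finrank K V = 4) {W : Submodule K V} (hW : finrank K W = 2)
    (x₀ : V) : (lineSetIn B (translate x₀ W)).ncard ≤ 2 := by
  have : Finite V := Module.finite_of_finite K
  by_contra h
  rw [not_le, Set.two_lt_ncard_iff (Set.toFinite _)] at h
  obtain ⟨ℓ₁, ℓ₂, ℓ₃, h₁, h₂', h₃, h12, h13, h23⟩ := h
  exact no_three_lines_in_plane hB hBs h2 h4 hW x₀ h₁ h₂' h₃ h12 h13 h23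

end Plane

section ThreeSpace

variable [FiniteDimensional K V] {B : LinearMap.BilinForm K V}

omit [FiniteDimensional K V] in
/-- The lines of `L` inside `x₀ + U` through `p` are among the lines `{p + t v}` with `v` a null
vector of `U`. [folklore] -/
theorem linesThroughIn_subset_image (U : Submodule K V) (x₀ p : V) :
    linesThroughIn B p (translate x₀ U) ⊆
      (fun v => line K p v) '' {v : V | v ∈ U ∧ B v v = 0} := by
  rintro ℓ ⟨hℓ, hS, hp⟩
  obtain ⟨v, -, -, hvv, rfl⟩ := exists_eq_line_of_mem hℓ hp
  exact ⟨v, ⟨mem_of_line_subset hS, hvv⟩, rfl⟩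

/-- Through any point pass at most `2q²` lines of `L` inside a given affine `3`-space (crude bound,
used only at the `≤ 2` exceptional points).
[cite: Tao2005FiniteFieldBesicovitch4D, Prop. 1.3, proof (§3, p. 342)] -/
theorem ncard_linesThroughIn_le [Finite K] (hB : B.Nondegenerate) (hBs : B.IsSymm)
    (h2 : (2 : K) ≠ 0) (h4 : finrank K V = 4) {U : Submodule K V} (hU : finrank K U = 3)
    (x₀ p : V) : (linesThroughIn B p (translate x₀ U)).ncard ≤ 2 * Nat.card K ^ 2 := by
  have : Finite V := Module.finite_of_finite K
  exact (Set.ncard_le_ncard (linesThroughIn_subset_image U x₀ p) (Set.toFinite _)).trans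
    ((Set.ncard_image_le (Set.toFinite _)).trans (ncard_null_le hB hBs h2 h4 hU))

omit [FiniteDimensional K V] in
/-- `v ∈ (K p)^⊥ ⟺ ⟨v, p⟩ = 0` (symmetric `B`). [folklore] -/
theorem mem_orthogonal_span_singleton_iff (hBs : B.IsSymm) {p v : V} :
    v ∈ B.orthogonal (K ∙ p) ↔ B v p = 0 := by
  rw [LinearMap.BilinForm.mem_orthogonal_iff]
  constructor
  · intro h
    rw [← hBs.eq p v]
    exact h p (Submodule.mem_span_singleton_self p)
  · intro h n hn
    obtain ⟨a, rfl⟩ := Submodule.mem_span_singleton.1 hn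
    rw [LinearMap.map_smul₂, smul_eq_mul, hBs.eq p v, h, mul_zero]

/-- **At most two lines of `L` inside a `3`-space `x₀ + U` pass through a point `p` with
`U ⊄ p^⊥`** (otherwise three null directions in the plane `U ∩ p^⊥` would make it totally
isotropic and orthogonal to the unit vector `p`).
[cite: Tao2005FiniteFieldBesicovitch4D, Prop. 1.3, proof (§3, p. 342)] -/
theorem ncard_linesThroughIn_le_two [Finite K] (hB : B.Nondegenerate) (hBs : B.IsSymm)
    (h2 : (2 : K) ≠ 0) (h4 : finrank K V = 4) {U : Submodule K V} (hU : finrank K U = 3)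
    {x₀ p : V} (hgood : ∃ u ∈ U, B u p ≠ 0) :
    (linesThroughIn B p (translate x₀ U)).ncard ≤ 2 := by
  have : Finite V := Module.finite_of_finite K
  by_contra h
  rw [not_le, Set.two_lt_ncard_iff (Set.toFinite _)] at h
  obtain ⟨ℓ₁, ℓ₂, ℓ₃, ⟨hℓ₁, hS₁, hp₁⟩, ⟨hℓ₂, hS₂, hp₂⟩, ⟨hℓ₃, hS₃, hp₃⟩, h12, h13, h23⟩ := h
  have hpp : B p p = 1 := apply_self_eq_one_of_mem hBs hℓ₁ hp₁
  obtain ⟨v₁, hv₁, hv₁p, hv₁v, rfl⟩ := exists_eq_line_of_mem hℓ₁ hp₁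
  obtain ⟨v₂, hv₂, hv₂p, hv₂v, rfl⟩ := exists_eq_line_of_mem hℓ₂ hp₂
  obtain ⟨v₃, hv₃, hv₃p, hv₃v, rfl⟩ := exists_eq_line_of_mem hℓ₃ hp₃
  have hv₁U : v₁ ∈ U := mem_of_line_subset hS₁
  have hv₂U : v₂ ∈ U := mem_of_line_subset hS₂
  have hv₃U : v₃ ∈ U := mem_of_line_subset hS₃
  -- distinct lines through `p` have non-proportional directions
  have np : ∀ {u u' : V}, u' ≠ 0 → line K p u ≠ line K p u' → ∀ c : K, u' ≠ c • u := by
    intro u u' hu' hne c hc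
    have hc0 : c ≠ 0 := by rintro rfl; rw [zero_smul] at hc; exact hu' hc
    exact hne (by rw [hc, line_smul p u hc0])
  -- the plane `W' = U ∩ p^⊥`
  let W' : Submodule K V := U ⊓ B.orthogonal (K ∙ p)
  have hmem : ∀ {v : V}, v ∈ U → B v p = 0 → v ∈ W' := fun hvU hvp =>
    ⟨hvU, (mem_orthogonal_span_singleton_iff hBs).2 hvp⟩
  have hlt : W' < U := by
    obtain ⟨u, huU, hup⟩ := hgood
    refine lt_of_le_of_ne inf_le_left fun heq => hup ?_
    have huW' : u ∈ W' := by rw [heq]; exact huU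
    exact (mem_orthogonal_span_singleton_iff hBs).1 huW'.2
  have hW'2 : finrank K W' ≤ 2 := by
    have h' := Submodule.finrank_lt_finrank_of_lt hlt
    omega
  obtain ⟨hspan, hW'eq⟩ :=
    span_pair_eq_of_finrank_le_two hW'2 (hmem hv₁U hv₁p) (hmem hv₂U hv₂p) hv₁ (np hv₂ h12)
  have hv₃W : v₃ ∈ Submodule.span K ({v₁, v₂} : Set V) := hspan.symm ▸ hmem hv₃U hv₃p
  obtain ⟨a, b, hab⟩ := Submodule.mem_span_pair.1 hv₃W
  have ha : a ≠ 0 := by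
    rintro rfl
    exact np hv₃ h23 b (by rw [← hab, zero_smul, zero_add])
  have hb : b ≠ 0 := by
    rintro rfl
    exact np hv₃ h13 a (by rw [← hab, zero_smul, add_zero])
  have h₁₂ := apply_eq_zero_of_three_null hBs h2 hv₁v hv₂v ha hb (hab.symm ▸ hv₃v)
  have hiso := isotropic_span_pair hBs hv₁v hv₂v h₁₂
  have hperp : ∀ w ∈ Submodule.span K ({v₁, v₂} : Set V), B w p = 0 := by
    intro w hw
    obtain ⟨a', b', rfl⟩ := Submodule.mem_span_pair.1 hw
    rw [LinearMap.map_add₂, LinearMap.map_smul₂, LinearMap.map_smul₂, hv₁p, hv₂p, smul_zero,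
      smul_zero, add_zero]
  have h0 := apply_self_eq_zero_of_isotropic_plane hB h4 (hspan.symm ▸ hW'eq) hiso hperp
  rw [hpp] at h0
  exact one_ne_zero h0

/-- **At most two exceptional points:** the unit vectors `p` with `U ⊆ p^⊥` lie on the line `U^⊥`,
which meets the sphere in at most two (antipodal) points. [folklore] -/
theorem no_three_bad (hB : B.Nondegenerate) (h4 : finrank K V = 4)
    {U : Submodule K V} (hU : finrank K U = 3) {p₁ p₂ p₃ : V} (hp₁ : B p₁ p₁ = 1)
    (hp₂ : B p₂ p₂ = 1) (hp₃ : B p₃ p₃ = 1) (hb₁ : ∀ u ∈ U, B u p₁ = 0)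
    (hb₂ : ∀ u ∈ U, B u p₂ = 0) (hb₃ : ∀ u ∈ U, B u p₃ = 0) (h12 : p₁ ≠ p₂) (h13 : p₁ ≠ p₃)
    (h23 : p₂ ≠ p₃) : False := by
  have hfin : finrank K (B.orthogonal U) = 1 := by
    rw [LinearMap.BilinForm.finrank_orthogonal hB, h4, hU]
  have hm₁ : p₁ ∈ B.orthogonal U := LinearMap.BilinForm.mem_orthogonal_iff.2 hb₁
  have hm₂ : p₂ ∈ B.orthogonal U := LinearMap.BilinForm.mem_orthogonal_iff.2 hb₂
  have hm₃ : p₃ ∈ B.orthogonal U := LinearMap.BilinForm.mem_orthogonal_iff.2 hb₃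
  have hp₁0 : (⟨p₁, hm₁⟩ : B.orthogonal U) ≠ 0 := by
    intro h
    have h' : p₁ = 0 := by simpa using congrArg Subtype.val h
    rw [h', map_zero] at hp₁
    exact absurd hp₁ zero_ne_one
  have hgen := (finrank_eq_one_iff_of_nonzero' _ hp₁0).1 hfin
  -- every unit vector on the line `K p₁` is `± p₁`
  have pm : ∀ {p : V} (hm : p ∈ B.orthogonal U), B p p = 1 → p = p₁ ∨ p = -p₁ := by
    intro p hm hp
    obtain ⟨c, hc⟩ := hgen ⟨p, hm⟩
    rw [Subtype.ext_iff] at hc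
    simp only [SetLike.mk_smul_mk] at hc
    -- hc : c • p₁ = p
    rw [← hc, LinearMap.map_smul₂, map_smul, smul_eq_mul, smul_eq_mul, hp₁, mul_one,
      mul_self_eq_one_iff] at hp
    rcases hp with rfl | rfl
    · left; rw [← hc, one_smul]
    · right; rw [← hc, neg_one_smul]
  rcases pm hm₂ hp₂ with e₂ | e₂
  · exact h12 e₂.symm
  rcases pm hm₃ hp₃ with e₃ | e₃
  · exact h13 e₃.symm
  exact h23 (e₂.trans e₃.symm)

/-- Every line of `L` has `|K|` points. [folklore] -/
noncomputable def lineEquiv {ℓ : Set V} (hℓ : ℓ ∈ lineSet B) : ℓ ≃ K :=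
  (Equiv.setCongr hℓ.choose_spec.choose_spec.2.2.2.2).trans
    (Equiv.ofInjective _ (line_injective hℓ.choose hℓ.choose_spec.choose_spec.1)).symm

/-- The incidence set `{(p, ℓ) : ℓ ∈ L, ℓ ⊆ S, p ∈ ℓ}` fibred over the points of `S ∩ P` and
over the lines of `L` inside `S`. [folklore] -/
def incidenceEquivIn (hBs : B.IsSymm) (S : Set V) :
    (Σ p : (S ∩ sphere B : Set V), (linesThroughIn B (p : V) S)) ≃
      (Σ ℓ : (lineSetIn B S), (ℓ : Set V)) where
  toFun z := ⟨⟨z.2.1, z.2.2.1, z.2.2.2.1⟩, ⟨z.1.1, z.2.2.2.2⟩⟩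
  invFun y := ⟨⟨y.2.1, y.1.2.2 y.2.2, subset_sphere_of_mem_lineSet hBs y.1.2.1 y.2.2⟩,
    ⟨y.1.1, y.1.2.1, y.1.2.2, y.2.2⟩⟩
  left_inv _ := rfl
  right_inv _ := rfl

omit [FiniteDimensional K V] in
/-- The incidence set over the lines of `L` inside `S` has `#(lines) · |K|` elements.
[folklore] -/
theorem natCard_incidence (S : Set V) :
    Nat.card (Σ ℓ : (lineSetIn B S), (ℓ : Set V)) = (lineSetIn B S).ncard * Nat.card K := by
  have e : (Σ ℓ : (lineSetIn B S), (ℓ : Set V)) ≃ (lineSetIn B S) × K :=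
    (Equiv.sigmaCongrRight fun ℓ => lineEquiv ℓ.2.1).trans (Equiv.sigmaEquivProd _ _)
  rw [Nat.card_congr e, Nat.card_prod, Nat.card_coe_set_eq]

/-- **The Wolff axiom for `k = 3`, with Tao's exponent: every affine `3`-space `x₀ + U` contains
at most `8q = O(|F|)` lines of `L`** ("the number of lines in `λ` is at most `O(|F|)`, which
clearly implies the Wolff axiom for both `k = 2` and `k = 3`", p. 342).  Proof by double counting
incidences in `x₀ + U`: `q · #lines = Σ_p #(lines through p) ≤ 2 · |P ∩ (x₀ + U)| + 2 · 2q²`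
(at most two lines through each point, except at the `≤ 2` points of `U^⊥ ∩ P`, through which
at most `2q²` lines pass), and `|P ∩ (x₀ + U)| ≤ 2q²`.
[cite: Tao2005FiniteFieldBesicovitch4D, Prop. 1.3, proof (§3, p. 342)] -/
theorem ncard_lineSetIn_le [Finite K] (hB : B.Nondegenerate) (hBs : B.IsSymm) (h2 : (2 : K) ≠ 0)
    (h4 : finrank K V = 4) {U : Submodule K V} (hU : finrank K U = 3) (x₀ : V) :
    (lineSetIn B (translate x₀ U)).ncard ≤ 8 * Nat.card K := by
  classical
  have : Finite V := Module.finite_of_finite K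
  set S := translate x₀ U with hSdef
  haveI : Fintype (S ∩ sphere B : Set V) := Fintype.ofFinite _
  have hcount : (lineSetIn B S).ncard * Nat.card K =
      ∑ p : (S ∩ sphere B : Set V), (linesThroughIn B (p : V) S).ncard := by
    rw [← natCard_incidence S, ← Nat.card_congr (incidenceEquivIn hBs S), Nat.card_sigma]
    simp only [Nat.card_coe_set_eq]
  let bad : (S ∩ sphere B : Set V) → Prop := fun p => ∀ u ∈ U, B u p = 0
  let m : (S ∩ sphere B : Set V) → ℕ := fun p => (linesThroughIn B (p : V) S).ncard
  have hbad_card : (Finset.univ.filter bad).card ≤ 2 := by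
    by_contra h
    rw [not_le, Finset.two_lt_card_iff] at h
    obtain ⟨a, b, c, ha, hb, hc, hab, hac, hbc⟩ := h
    simp only [Finset.mem_filter, Finset.mem_univ, true_and] at ha hb hc
    exact no_three_bad hB h4 hU a.2.2 b.2.2 c.2.2 ha hb hc
      (fun h => hab (Subtype.ext h)) (fun h => hac (Subtype.ext h)) (fun h => hbc (Subtype.ext h))
  have hbad_sum : ∑ p ∈ Finset.univ.filter bad, m p ≤
      (Finset.univ.filter bad).card • (2 * Nat.card K ^ 2) :=
    Finset.sum_le_card_nsmul _ _ _ (fun p _ => ncard_linesThroughIn_le hB hBs h2 h4 hU x₀ p)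
  have hgood_sum : ∑ p ∈ Finset.univ.filter (fun p => ¬ bad p), m p ≤
      (Finset.univ.filter (fun p => ¬ bad p)).card • 2 :=
    Finset.sum_le_card_nsmul _ _ _ (fun p hp => by
      simp only [Finset.mem_filter, Finset.mem_univ, true_and, bad] at hp
      push Not at hp
      exact ncard_linesThroughIn_le_two hB hBs h2 h4 hU hp)
  have hgood_card : (Finset.univ.filter (fun p => ¬ bad p)).card ≤ 2 * Nat.card K ^ 2 := by
    refine (Finset.card_filter_le _ _).trans ?_
    rw [Finset.card_univ, ← Nat.card_eq_fintype_card, Nat.card_coe_set_eq]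
    exact ncard_translate_inter_sphere_le hB hBs h2 h4 hU x₀
  have hsum : ∑ p, m p ≤ 8 * Nat.card K ^ 2 := by
    rw [← Finset.sum_filter_add_sum_filter_not Finset.univ bad m]
    refine (add_le_add hbad_sum hgood_sum).trans ?_
    rw [smul_eq_mul, smul_eq_mul]
    nlinarith [hbad_card, hgood_card]
  have hq : 0 < Nat.card K := Nat.card_pos
  refine Nat.le_of_mul_le_mul_right ?_ hq
  calc (lineSetIn B S).ncard * Nat.card K = ∑ p, m p := hcount
    _ ≤ 8 * Nat.card K ^ 2 := hsum
    _ = 8 * Nat.card K * Nat.card K := by ring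

/-- **The Wolff axiom (Tao's Definition 1.1, `n = 4`) for `L`, general nondegenerate form:**
every affine `2`-plane contains at most `2` lines of `L` and every affine `3`-space at most `8q`
(`K = 𝔽_q`, `q` odd). [cite: Tao2005FiniteFieldBesicovitch4D, Prop. 1.3 (§1, p. 338)] -/
theorem wolffAxiom [Finite K] (hB : B.Nondegenerate) (hBs : B.IsSymm) (h2 : (2 : K) ≠ 0)
    (h4 : finrank K V = 4) :
    (∀ (W : Submodule K V) (x₀ : V), finrank K W = 2 →
        (lineSetIn B (translate x₀ W)).ncard ≤ 2) ∧
      ∀ (U : Submodule K V) (x₀ : V), finrank K U = 3 →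
        (lineSetIn B (translate x₀ U)).ncard ≤ 8 * Nat.card K :=
  ⟨fun _ x₀ hW => ncard_lineSetIn_plane_le_two hB hBs h2 h4 hW x₀,
    fun _ x₀ hU => ncard_lineSetIn_le hB hBs h2 h4 hU x₀⟩

end ThreeSpace

section LineCount

variable [FiniteDimensional K V] {B : LinearMap.BilinForm K V}

variable (B) in
/-- The generating pairs `(x, v)` of Tao's family `L`. [folklore] -/
def genPairs : Set (V × V) := {z | z.2 ≠ 0 ∧ B z.1 z.1 = 1 ∧ B z.2 z.1 = 0 ∧ B z.2 z.2 = 0}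

omit [FiniteDimensional K V] in
/-- A generating pair generates a line of `L`. [folklore] -/
theorem line_mem_lineSet {z : V × V} (hz : z ∈ genPairs B) : line K z.1 z.2 ∈ lineSet B :=
  ⟨z.1, z.2, hz.1, hz.2.1, hz.2.2.1, hz.2.2.2, rfl⟩

/-- The line generated by a pair, as an element of `L`. [folklore] -/
def gen (z : genPairs B) : lineSet B := ⟨line K z.1.1 z.1.2, line_mem_lineSet z.2⟩

omit [FiniteDimensional K V] in
/-- **Each line of `L` is generated by exactly `q (q − 1)` pairs** `(x + s v, c v)`, `s ∈ K`,
`c ∈ Kˣ` ("each line in `L` is generated by `∼ |F|²` such pairs `(x, v)`", p. 342).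
[cite: Tao2005FiniteFieldBesicovitch4D, Prop. 1.3, proof (§3, p. 342)] -/
theorem natCard_fiber (hBs : B.IsSymm) (ℓ : lineSet B) :
    Nat.card {z : genPairs B // gen z = ℓ} = Nat.card K * Nat.card Kˣ := by
  obtain ⟨x, v, hv, hx, hvx, hvv, hℓ⟩ := ℓ.2
  have hmem : ∀ (s : K) (c : Kˣ), (x + s • v, (c : K) • v) ∈ genPairs B := fun s c => by
    refine ⟨smul_ne_zero (Units.ne_zero c) hv, ?_, ?_, ?_⟩
    · show B (x + s • v) (x + s • v) = 1
      rw [apply_add_smul_self, hBs.eq x v, hvx, hvv, hx]; ring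
    · show B ((c : K) • v) (x + s • v) = 0
      rw [LinearMap.map_smul₂, map_add, map_smul, smul_eq_mul, smul_eq_mul, hvx, hvv]; ring
    · show B ((c : K) • v) ((c : K) • v) = 0
      rw [LinearMap.map_smul₂, map_smul, smul_eq_mul, smul_eq_mul, hvv]; ring
  have hgen : ∀ (s : K) (c : Kˣ), gen ⟨(x + s • v, (c : K) • v), hmem s c⟩ = ℓ := fun s c => by
    apply Subtype.ext
    show line K (x + s • v) ((c : K) • v) = (ℓ : Set V)
    rw [hℓ, line_smul _ _ (Units.ne_zero c), line_eq_of_mem (add_smul_mem_line x v s)]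
  let f : K × Kˣ → {z : genPairs B // gen z = ℓ} := fun sc =>
    ⟨⟨(x + sc.1 • v, (sc.2 : K) • v), hmem sc.1 sc.2⟩, hgen sc.1 sc.2⟩
  have hf : Function.Bijective f := by
    constructor
    · rintro ⟨s, c⟩ ⟨s', c'⟩ h
      simp only [f, Subtype.mk.injEq, Prod.mk.injEq] at h
      obtain ⟨h1, h2⟩ := h
      have hs : s = s' := line_injective x hv h1
      have hc : (c : K) = c' := by
        have h' : ((c : K) - c') • v = 0 := by rw [sub_smul, h2, sub_self]
        rcases smul_eq_zero.1 h' with h'' | h''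
        · exact sub_eq_zero.1 h''
        · exact absurd h'' hv
      rw [hs, Units.ext hc]
    · rintro ⟨⟨⟨x', v'⟩, hz⟩, hzℓ⟩
      have hℓ' : line K x' v' = line K x v := by
        have h' := congrArg Subtype.val hzℓ
        rw [hℓ] at h'
        exact h'
      have hx' : x' ∈ line K x v := hℓ' ▸ mem_line_self x' v'
      obtain ⟨s, hs⟩ := hx'
      dsimp only at hs
      have hvv' : line K x' v = line K x' v' := by rw [hℓ', line_eq_of_mem ⟨s, hs⟩]
      obtain ⟨c, hc0, hc⟩ := exists_eq_smul_of_line_eq hz.1 hvv'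
      refine ⟨(s, Units.mk0 c hc0), ?_⟩
      apply Subtype.ext
      apply Subtype.ext
      show (x + s • v, (Units.mk0 c hc0 : K) • v) = (x', v')
      rw [Units.val_mk0, hs]
      exact congrArg (Prod.mk x') hc.symm
  rw [← Nat.card_eq_of_bijective f hf, Nat.card_prod]

/-- **`|L| · q (q − 1) = #(generating pairs)`.** [folklore] -/
theorem ncard_lineSet_mul_eq [Finite K] (hBs : B.IsSymm) :
    (lineSet B).ncard * (Nat.card K * Nat.card Kˣ) = (genPairs B).ncard := by
  classical
  have : Finite V := Module.finite_of_finite K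
  haveI : Fintype (lineSet B) := Fintype.ofFinite _
  have e := (Equiv.sigmaFiberEquiv (gen (B := B))).symm
  rw [← Nat.card_coe_set_eq (genPairs B), Nat.card_congr e, Nat.card_sigma,
    ← Nat.card_coe_set_eq (lineSet B), Nat.card_eq_fintype_card, ← Finset.card_univ,
    ← smul_eq_mul, ← Finset.sum_const]
  exact Finset.sum_congr rfl (fun ℓ _ => (natCard_fiber hBs ℓ).symm)

/-- **At most `4q⁵` generating pairs** ("there are `∼ |F|⁵` possible pairs `(x, v)`", p. 342;
upper half): at most `2q³` null vectors `v`, and for each `v ≠ 0` at most `2q²` unit vectors in the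
`3`-space `v^⊥`. [cite: Tao2005FiniteFieldBesicovitch4D, Prop. 1.3, proof (§3, p. 342)] -/
theorem ncard_genPairs_le [Finite K] (hB : B.Nondegenerate) (hBs : B.IsSymm) (h2 : (2 : K) ≠ 0)
    (h4 : finrank K V = 4) : (genPairs B).ncard ≤ 4 * Nat.card K ^ 5 := by
  have : Finite V := Module.finite_of_finite K
  have hfib : ∀ v : V, {z ∈ genPairs B | z.2 = v}.ncard ≤ 2 * Nat.card K ^ 2 := by
    intro v
    by_cases hv : v = 0
    · have he : {z ∈ genPairs B | z.2 = v} = ∅ := by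
        ext z
        simp only [Set.mem_setOf_eq, Set.mem_empty_iff_false, iff_false, not_and]
        intro hz hzv
        exact hz.1 (hzv.trans hv)
      rw [he, Set.ncard_empty]
      exact Nat.zero_le _
    · have hsub : {z ∈ genPairs B | z.2 = v} ⊆
          (fun x => (x, v)) '' {x : V | x ∈ B.orthogonal (K ∙ v) ∧ B x x = 1} := by
        rintro ⟨x, v'⟩ ⟨⟨-, hx, hvx, -⟩, hv'⟩
        simp only at hv'
        subst hv'
        refine ⟨x, ⟨(mem_orthogonal_span_singleton_iff hBs).2 ?_, hx⟩, rfl⟩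
        rw [hBs.eq x v']
        exact hvx
      have hU : finrank K (B.orthogonal (K ∙ v)) = 3 := by
        rw [LinearMap.BilinForm.finrank_orthogonal hB, h4, finrank_span_singleton hv]
      exact (Set.ncard_le_ncard hsub (Set.toFinite _)).trans
        ((Set.ncard_image_le (Set.toFinite _)).trans (ncard_level_le hB hBs h2 h4 hU 1))
  have h1 := ncard_le_mul_ncard_image (genPairs B) Prod.snd (2 * Nat.card K ^ 2) hfib
  have himg : (Prod.snd '' genPairs B).ncard ≤ 2 * Nat.card K ^ 3 :=
    (Set.ncard_le_ncard (by rintro _ ⟨z, hz, rfl⟩; exact hz.2.2.2) (Set.toFinite _)).trans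
      (ncard_null_le' hB hBs h2 h4)
  calc (genPairs B).ncard ≤ 2 * Nat.card K ^ 2 * (Prod.snd '' genPairs B).ncard := h1
    _ ≤ 2 * Nat.card K ^ 2 * (2 * Nat.card K ^ 3) := Nat.mul_le_mul_left _ himg
    _ = 4 * Nat.card K ^ 5 := by ring

/-- `|L| · (q − 1) ≤ 4q⁴`. [cite: Tao2005FiniteFieldBesicovitch4D, Prop. 1.3 (§1, p. 338)] -/
theorem ncard_lineSet_mul_le' [Finite K] (hB : B.Nondegenerate) (hBs : B.IsSymm)
    (h2 : (2 : K) ≠ 0) (h4 : finrank K V = 4) :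
    (lineSet B).ncard * (Nat.card K - 1) ≤ 4 * Nat.card K ^ 4 := by
  have h := (ncard_lineSet_mul_eq hBs).le.trans (ncard_genPairs_le hB hBs h2 h4)
  rw [Nat.card_units] at h
  have hq : 0 < Nat.card K := Nat.card_pos
  refine Nat.le_of_mul_le_mul_right ?_ hq
  calc (lineSet B).ncard * (Nat.card K - 1) * Nat.card K
      = (lineSet B).ncard * (Nat.card K * (Nat.card K - 1)) := by ring
    _ ≤ 4 * Nat.card K ^ 5 := h
    _ = 4 * Nat.card K ^ 4 * Nat.card K := by ring

/-- **`|L| ≲ |F|³`, explicitly `|L| ≤ 6q³` for `q ≥ 3`** (`B` nondegenerate symmetric on a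
`4`-space over `𝔽_q`, `q` odd). [cite: Tao2005FiniteFieldBesicovitch4D, Prop. 1.3 (§1, p. 338)] -/
theorem ncard_lineSet_le [Finite K] (hB : B.Nondegenerate) (hBs : B.IsSymm) (h2 : (2 : K) ≠ 0)
    (h4 : finrank K V = 4) (hq : 2 < Nat.card K) : (lineSet B).ncard ≤ 6 * Nat.card K ^ 3 := by
  have h := ncard_lineSet_mul_le' hB hBs h2 h4
  obtain ⟨r, hr⟩ : ∃ r, Nat.card K = r + 1 := ⟨Nat.card K - 1, by omega⟩
  rw [hr, Nat.add_sub_cancel] at h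
  rw [hr]
  have hr2 : 2 ≤ r := by omega
  have hr0 : 0 < r := by omega
  refine Nat.le_of_mul_le_mul_right ?_ hr0
  calc (lineSet B).ncard * r ≤ 4 * (r + 1) ^ 4 := h
    _ = (4 * (r + 1)) * (r + 1) ^ 3 := by ring
    _ ≤ (6 * r) * (r + 1) ^ 3 := Nat.mul_le_mul_right _ (by omega)
    _ = 6 * (r + 1) ^ 3 * r := by ring

end LineCount

section LowerBound

variable {B : LinearMap.BilinForm K V}

/-- `char K ≠ 2` from `(2 : K) ≠ 0`. [folklore] -/
theorem ringChar_ne_two (h2 : (2 : K) ≠ 0) : ringChar K ≠ 2 := by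
  intro h
  apply h2
  have h' := ringChar.Nat.cast_ringChar (R := K)
  rw [h] at h'
  exact_mod_cast h'

/-- A finite field with `char ≠ 2` has at least `3` elements. [folklore] -/
theorem two_lt_card [Finite K] (h2 : (2 : K) ≠ 0) : 2 < Nat.card K := by
  classical
  haveI := Fintype.ofFinite K
  have hodd := FiniteField.odd_card_of_char_ne_two (hF := ringChar_ne_two (K := K) h2)
  have h1 : 1 < Fintype.card K := Fintype.one_lt_card
  rw [Nat.card_eq_fintype_card]
  omega

/-- **Conic count** (the representation count behind Tao's Lemma 3.1, (3–2), for rank `2`, lower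
half, elementary): for `a, b, e ≠ 0` in a finite field of odd characteristic the conic
`a s² + b t² = e` has at least `q − 2` points — one point exists (pigeonhole on squares,
`FiniteField.exists_root_sum_quadratic`), and the secants through it of all but `≤ 3` slopes meet
the conic again in distinct points. [folklore] -/
theorem card_le_ncard_conic_add_two [Finite K] (h2 : (2 : K) ≠ 0) {a b e : K} (ha : a ≠ 0)
    (hb : b ≠ 0) (he : e ≠ 0) :
    Nat.card K ≤ {z : K × K | a * z.1 ^ 2 + b * z.2 ^ 2 = e}.ncard + 2 := by
  classical
  haveI := Fintype.ofFinite K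
  -- Step 1: a point on the conic
  obtain ⟨s₀, t₀, h₀⟩ : ∃ s₀ t₀ : K, a * s₀ ^ 2 + b * t₀ ^ 2 = e := by
    have hf : (Polynomial.C a * Polynomial.X ^ 2).degree = 2 := by
      rw [Polynomial.degree_C_mul_X_pow 2 ha]; rfl
    have hg : (Polynomial.C b * Polynomial.X ^ 2 - Polynomial.C e).degree = 2 := by
      rw [Polynomial.degree_sub_C, Polynomial.degree_C_mul_X_pow 2 hb]
      · rfl
      · rw [Polynomial.degree_C_mul_X_pow 2 hb]
        exact_mod_cast Nat.zero_lt_two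
    obtain ⟨s₀, t₀, hst⟩ := FiniteField.exists_root_sum_quadratic hf hg
      (FiniteField.odd_card_of_char_ne_two (ringChar_ne_two h2))
    refine ⟨s₀, t₀, ?_⟩
    simp only [Polynomial.eval_mul, Polynomial.eval_C, Polynomial.eval_pow, Polynomial.eval_X,
      Polynomial.eval_sub] at hst
    linear_combination hst
  -- Step 2: the secant map
  set N : Set (K × K) := {z | a * z.1 ^ 2 + b * z.2 ^ 2 = e} with hN
  let M : Set K := {m | a + b * m ^ 2 ≠ 0 ∧ a * s₀ + b * t₀ * m ≠ 0}
  let τ : K → K := fun m => -(2 * (a * s₀ + b * t₀ * m)) / (a + b * m ^ 2)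
  let P : K → K × K := fun m => (s₀ + τ m, t₀ + τ m * m)
  have hτ : ∀ m ∈ M, τ m ≠ 0 := fun m hm =>
    div_ne_zero (neg_ne_zero.2 (mul_ne_zero h2 hm.2)) hm.1
  have hPN : ∀ m ∈ M, P m ∈ N := fun m hm => by
    have hτd : τ m * (a + b * m ^ 2) = -(2 * (a * s₀ + b * t₀ * m)) := div_mul_cancel₀ _ hm.1
    show a * (s₀ + τ m) ^ 2 + b * (t₀ + τ m * m) ^ 2 = e
    linear_combination h₀ + (τ m) * hτd
  have hPinj : Set.InjOn P M := by
    intro m hm m' hm' hP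
    simp only [P, Prod.mk.injEq] at hP
    obtain ⟨h1, h2'⟩ := hP
    have hτeq : τ m = τ m' := add_left_cancel h1
    rw [hτeq] at h2'
    exact mul_left_cancel₀ (hτ m' hm') (add_left_cancel h2')
  have hP0 : ∀ m ∈ M, P m ≠ (s₀, t₀) := fun m hm hP => by
    simp only [P, Prod.mk.injEq] at hP
    exact hτ m hm (by linear_combination hP.1)
  -- Step 3: all but at most three slopes are admissible
  have hM : Nat.card K ≤ M.ncard + 3 := by
    have hR₁ : {m : K | a + b * m ^ 2 = 0}.ncard ≤ 2 := by
      have hset : {m : K | a + b * m ^ 2 = 0} = {m : K | b * m ^ 2 + 0 * m + a = 0} := by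
        ext m
        simp only [Set.mem_setOf_eq]
        constructor <;> intro h <;> linear_combination h
      rw [hset]
      exact ncard_quadratic_le_two hb
    have hR₂ : {m : K | a * s₀ + b * t₀ * m = 0}.ncard ≤ 1 := by
      by_cases ht₀ : t₀ = 0
      · have has₀ : a * s₀ ≠ 0 := by
          intro h
          have hs₀ : s₀ = 0 := by
            rcases mul_eq_zero.1 h with h' | h'
            · exact absurd h' ha
            · exact h'
          apply he
          rw [← h₀, hs₀, ht₀]
          ring
        have hset : {m : K | a * s₀ + b * t₀ * m = 0} = ∅ := by
          ext m
          simp only [Set.mem_setOf_eq, Set.mem_empty_iff_false, iff_false, ht₀, mul_zero,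
            zero_mul, add_zero]
          exact has₀
        rw [hset, Set.ncard_empty]
        exact Nat.zero_le _
      · rw [Set.ncard_le_one (Set.toFinite _)]
        intro m hm m' hm'
        simp only [Set.mem_setOf_eq] at hm hm'
        have h' : b * t₀ * (m - m') = 0 := by linear_combination hm - hm'
        rcases mul_eq_zero.1 h' with h'' | h''
        · exact absurd h'' (mul_ne_zero hb ht₀)
        · exact sub_eq_zero.1 h''
    have hcover : (Set.univ : Set K) ⊆
        M ∪ ({m | a + b * m ^ 2 = 0} ∪ {m | a * s₀ + b * t₀ * m = 0}) := by
      intro m _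
      by_cases h1 : a + b * m ^ 2 = 0
      · exact Or.inr (Or.inl h1)
      by_cases h2' : a * s₀ + b * t₀ * m = 0
      · exact Or.inr (Or.inr h2')
      exact Or.inl ⟨h1, h2'⟩
    calc Nat.card K = (Set.univ : Set K).ncard := (Set.ncard_univ K).symm
      _ ≤ (M ∪ ({m | a + b * m ^ 2 = 0} ∪ {m | a * s₀ + b * t₀ * m = 0})).ncard :=
          Set.ncard_le_ncard hcover (Set.toFinite _)
      _ ≤ M.ncard + ({m | a + b * m ^ 2 = 0} ∪ {m | a * s₀ + b * t₀ * m = 0}).ncard :=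
          Set.ncard_union_le _ _
      _ ≤ M.ncard + ({m | a + b * m ^ 2 = 0}.ncard + {m | a * s₀ + b * t₀ * m = 0}.ncard) :=
          Nat.add_le_add_left (Set.ncard_union_le _ _) _
      _ ≤ M.ncard + 3 := by omega
  -- Step 4: the base point and the second intersection points are distinct points of the conic
  have hsub : insert (s₀, t₀) (P '' M) ⊆ N := by
    rintro z (rfl | ⟨m, hm, rfl⟩)
    · exact h₀
    · exact hPN m hm
  have hnot : (s₀, t₀) ∉ P '' M := by
    rintro ⟨m, hm, hPm⟩
    exact hP0 m hm hPm
  have hcard : (insert (s₀, t₀) (P '' M)).ncard = M.ncard + 1 := by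
    rw [Set.ncard_insert_of_notMem hnot (Set.toFinite _), hPinj.ncard_image]
  have hle := Set.ncard_le_ncard hsub (Set.toFinite N)
  omega

/-- Sums with few exceptional terms: if `n ≤ f i` off a set of at most `k` indices, then
`(|ι| − k) · n ≤ Σ f`. [folklore] -/
theorem sub_mul_le_sum {ι : Type*} [Fintype ι] (f : ι → ℕ) (p : ι → Prop) [DecidablePred p]
    {n k : ℕ} (hk : (Finset.univ.filter p).card ≤ k) (hf : ∀ i, ¬ p i → n ≤ f i) :
    (Fintype.card ι - k) * n ≤ ∑ i, f i := by
  have h1 : ∑ i ∈ Finset.univ.filter (fun i => ¬ p i), f i ≤ ∑ i, f i :=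
    Finset.sum_le_sum_of_subset (Finset.filter_subset _ _)
  have h2 : (Finset.univ.filter (fun i => ¬ p i)).card • n ≤
      ∑ i ∈ Finset.univ.filter (fun i => ¬ p i), f i :=
    Finset.card_nsmul_le_sum _ _ _ (fun i hi => hf i (Finset.mem_filter.1 hi).2)
  have h3 : (Finset.univ.filter p).card + (Finset.univ.filter (fun i => ¬ p i)).card =
      Fintype.card ι := by
    rw [Finset.card_filter_add_card_filter_not, Finset.card_univ]
  rw [smul_eq_mul] at h2
  calc (Fintype.card ι - k) * n ≤ (Finset.univ.filter (fun i => ¬ p i)).card * n :=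
        Nat.mul_le_mul_right _ (by omega)
    _ ≤ _ := h2.trans h1

/-- **Orthogonal splitting off a non-null vector:** `V = K u ⊕ u^⊥`, as a bijection
`(s, w) ↦ s u + w`. [folklore] -/
theorem bijective_decomp {u : V} (hu : B u u ≠ 0) :
    Function.Bijective (fun z : K × B.orthogonal (K ∙ u) => z.1 • u + (z.2 : V)) := by
  have hu0 : u ≠ 0 := ne_zero_of_apply_self_ne_zero hu
  constructor
  · rintro ⟨s, w⟩ ⟨s', w'⟩ h
    dsimp only at h
    have hmem : (s - s') • u ∈ (K ∙ u) ⊓ B.orthogonal (K ∙ u) := by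
      refine ⟨Submodule.smul_mem _ _ (Submodule.mem_span_singleton_self u), ?_⟩
      have e : (s - s') • u = (w' : V) - w := by
        rw [sub_smul, sub_eq_sub_iff_add_eq_add, h, add_comm]
      rw [e]
      exact Submodule.sub_mem _ w'.2 w.2
    rw [LinearMap.BilinForm.span_singleton_inf_orthogonal_eq_bot hu, Submodule.mem_bot,
      smul_eq_zero, sub_eq_zero] at hmem
    have hs : s = s' := hmem.resolve_right hu0
    subst hs
    have hw : (w : V) = w' := add_left_cancel h
    rw [Subtype.ext hw]
  · intro v
    have hv : v ∈ (K ∙ u) ⊔ B.orthogonal (K ∙ u) := by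
      rw [LinearMap.BilinForm.span_singleton_sup_orthogonal_eq_top hu]
      exact Submodule.mem_top
    obtain ⟨y, hy, z, hz, hyz⟩ := Submodule.mem_sup.1 hv
    obtain ⟨s, rfl⟩ := Submodule.mem_span_singleton.1 hy
    exact ⟨(s, ⟨z, hz⟩), hyz⟩

/-- **Slicing a level set along a non-null vector** (Tao's reduction "by adding dummy variables",
Lemma 3.1): `#{v : ⟨v, v⟩ = c} = Σ_{s ∈ K} #{w ∈ u^⊥ : ⟨w, w⟩ = c − ⟨u, u⟩ s²}`.
[cite: Tao2005FiniteFieldBesicovitch4D, Lemma 3.1] -/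
theorem natCard_level_eq_sum [Fintype K] [FiniteDimensional K V] (hBs : B.IsSymm) {u : V}
    (hu : B u u ≠ 0) (c : K) :
    Nat.card {v : V // B v v = c} =
      ∑ s : K, Nat.card {w : B.orthogonal (K ∙ u) // B (w : V) w = c - B u u * s ^ 2} := by
  have : Finite V := Module.finite_of_finite K
  let U' := B.orthogonal (K ∙ u)
  let φ : K × U' → V := fun z => z.1 • u + (z.2 : V)
  have hφ : Function.Bijective φ := bijective_decomp hu
  have hQ : ∀ z : K × U', B (φ z) (φ z) = B u u * z.1 ^ 2 + B (z.2 : V) z.2 := by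
    rintro ⟨s, w⟩
    have hw : B (w : V) u = 0 := (mem_orthogonal_span_singleton_iff hBs).1 w.2
    have hw' : B u w = 0 := by rw [hBs.eq u w]; exact hw
    simp only [φ, map_add, map_smul, LinearMap.add_apply, LinearMap.smul_apply, smul_eq_mul, hw,
      hw']
    ring
  have e1 : {z : K × U' // B (z.2 : V) z.2 = c - B u u * z.1 ^ 2} ≃ {v : V // B v v = c} :=
    Equiv.subtypeEquiv (Equiv.ofBijective φ hφ) (fun z => by
      rw [Equiv.ofBijective_apply, hQ z]
      constructor <;> intro h <;> linear_combination h)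
  have e2 : {z : K × U' // B (z.2 : V) z.2 = c - B u u * z.1 ^ 2} ≃
      Σ s : K, {w : U' // B (w : V) w = c - B u u * s ^ 2} :=
    Equiv.subtypeProdEquivSigmaSubtype (fun (s : K) (w : U') => B (w : V) w = c - B u u * s ^ 2)
  rw [← Nat.card_congr e1, Nat.card_congr e2, Nat.card_sigma]

/-- In a `1`-dimensional nondegenerate space a generator is non-null. [folklore] -/
theorem apply_self_ne_zero_of_finrank_one {W : Submodule K V} (hW : (B.restrict W).Nondegenerate)
    {u' : W} (hu' : u' ≠ 0) (hgen : ∀ w : W, ∃ c : K, c • u' = w) : B (u' : V) u' ≠ 0 := by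
  intro hb0
  apply hu'
  refine hW.1 u' (fun w => ?_)
  obtain ⟨c, rfl⟩ := hgen w
  rw [LinearMap.BilinForm.restrict_apply, LinearMap.domRestrict_apply, Submodule.coe_smul, map_smul,
    smul_eq_mul, hb0, mul_zero]

/-- **Rank `2`, lower half of (3–2):** on a nondegenerate plane over `𝔽_q` (`q` odd) the form
takes each nonzero value `e` at least `q − 2` times.
[cite: Tao2005FiniteFieldBesicovitch4D, Lemma 3.1] -/
theorem card_le_natCard_level_two [Finite K] [FiniteDimensional K V] (hB : B.Nondegenerate)
    (hBs : B.IsSymm) (h2 : (2 : K) ≠ 0) (hV : finrank K V = 2) {e : K} (he : e ≠ 0) :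
    Nat.card K ≤ Nat.card {v : V // B v v = e} + 2 := by
  classical
  haveI := Fintype.ofFinite K
  have : Finite V := Module.finite_of_finite K
  obtain ⟨u, -, hu⟩ := exists_apply_self_ne_zero hB hBs h2 (U := ⊤)
    (by rw [finrank_top, hV]; norm_num)
  have hu0 : u ≠ 0 := ne_zero_of_apply_self_ne_zero hu
  have hU'1 : finrank K (B.orthogonal (K ∙ u)) = 1 := by
    rw [LinearMap.BilinForm.finrank_orthogonal hB, hV, finrank_span_singleton hu0]
  obtain ⟨u', hu'0, hgen⟩ := finrank_eq_one_iff'.1 hU'1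
  have hb : B (u' : V) u' ≠ 0 :=
    apply_self_ne_zero_of_finrank_one
      (LinearMap.BilinForm.restrict_nondegenerate_orthogonal_spanSingleton B hB hBs.isRefl hu)
      hu'0 hgen
  rw [natCard_level_eq_sum hBs hu e]
  have hfib : ∀ d : K, Nat.card {w : (B.orthogonal (K ∙ u)) // B (w : V) w = d} =
      Nat.card {t : K // B (u' : V) u' * t ^ 2 = d} := by
    intro d
    have hbij : Function.Bijective (fun t : K => t • u') :=
      ⟨smul_left_injective K hu'0, fun w => hgen w⟩
    refine (Nat.card_congr (Equiv.subtypeEquiv (Equiv.ofBijective _ hbij) (fun t => ?_))).symm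
    simp only [Equiv.ofBijective_apply, Submodule.coe_smul, map_smul, LinearMap.smul_apply,
      smul_eq_mul]
    constructor <;> intro h <;> linear_combination h
  simp_rw [hfib]
  have hsum : ∑ s : K, Nat.card {t : K // B (u' : V) u' * t ^ 2 = e - B u u * s ^ 2} =
      Nat.card {z : K × K // B u u * z.1 ^ 2 + B (u' : V) u' * z.2 ^ 2 = e} := by
    rw [← Nat.card_sigma, ← Nat.card_congr (Equiv.subtypeProdEquivSigmaSubtype
      (fun s t => B (u' : V) u' * t ^ 2 = e - B u u * s ^ 2))]
    apply Nat.card_congr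
    exact Equiv.subtypeEquivRight (fun z => by
      constructor <;> intro h <;> linear_combination h)
  rw [hsum]
  have h := card_le_ncard_conic_add_two h2 hu hb he
  rw [← Nat.card_coe_set_eq] at h
  exact h

/-- The restriction of a symmetric form is symmetric. [folklore] -/
theorem isSymm_restrict (hBs : B.IsSymm) (W : Submodule K V) : (B.restrict W).IsSymm :=
  ⟨fun x y => by
    rw [LinearMap.BilinForm.restrict_apply, LinearMap.BilinForm.restrict_apply,
      LinearMap.domRestrict_apply, LinearMap.domRestrict_apply, hBs.eq]⟩

/-- **Rank `3`, lower half of (3–2):** on a nondegenerate `3`-space over `𝔽_q` (`q` odd) the form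
takes every value at least `(q − 2)²` times. [cite: Tao2005FiniteFieldBesicovitch4D, Lemma 3.1] -/
theorem sq_le_natCard_level_three [Finite K] [FiniteDimensional K V] (hB : B.Nondegenerate)
    (hBs : B.IsSymm) (h2 : (2 : K) ≠ 0) (hV : finrank K V = 3) (c : K) :
    (Nat.card K - 2) * (Nat.card K - 2) ≤ Nat.card {v : V // B v v = c} := by
  classical
  haveI := Fintype.ofFinite K
  have : Finite V := Module.finite_of_finite K
  obtain ⟨u, -, hu⟩ := exists_apply_self_ne_zero hB hBs h2 (U := ⊤)
    (by rw [finrank_top, hV]; norm_num)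
  have hu0 : u ≠ 0 := ne_zero_of_apply_self_ne_zero hu
  have hU'2 : finrank K (B.orthogonal (K ∙ u)) = 2 := by
    rw [LinearMap.BilinForm.finrank_orthogonal hB, hV, finrank_span_singleton hu0]
  have hB' := LinearMap.BilinForm.restrict_nondegenerate_orthogonal_spanSingleton B hB hBs.isRefl hu
  have hBs' := isSymm_restrict hBs (B.orthogonal (K ∙ u))
  rw [natCard_level_eq_sum hBs hu c]
  -- exceptional `s`: those with `c - ⟨u,u⟩ s² = 0`
  have hexc : (Finset.univ.filter (fun s : K => c - B u u * s ^ 2 = 0)).card ≤ 2 := by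
    have hset : ((Finset.univ.filter (fun s : K => c - B u u * s ^ 2 = 0)) : Set K) =
        {s : K | B u u * s ^ 2 + 0 * s + (-c) = 0} := by
      ext s
      simp only [Finset.coe_filter, Finset.mem_univ, true_and, Set.mem_setOf_eq]
      constructor <;> intro h <;> linear_combination -h
    rw [← Set.ncard_coe_finset, hset]
    exact ncard_quadratic_le_two hu
  have hmain : ∀ s : K, ¬ (c - B u u * s ^ 2 = 0) →
      Nat.card K - 2 ≤
        Nat.card {w : (B.orthogonal (K ∙ u)) // B (w : V) w = c - B u u * s ^ 2} := by
    intro s hs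
    have h' : Nat.card K ≤
        Nat.card {w : (B.orthogonal (K ∙ u)) // B (w : V) w = c - B u u * s ^ 2} + 2 := by
      have h'' := card_le_natCard_level_two hB' hBs' h2 hU'2 hs
      simp only [LinearMap.BilinForm.restrict_apply, LinearMap.domRestrict_apply] at h''
      exact h''
    omega
  have h := sub_mul_le_sum
    (fun s : K => Nat.card {w : (B.orthogonal (K ∙ u)) // B (w : V) w = c - B u u * s ^ 2})
    (fun s : K => c - B u u * s ^ 2 = 0) hexc hmain
  rwa [← Nat.card_eq_fintype_card] at h

/-- **Null vectors of a nondegenerate `3`-space:** at least `(q − 1)(q − 2)` nonzero ones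
("`∼ |F|²`" null vectors in `v^⊥ ≅ F³`, p. 342, lower half).
[cite: Tao2005FiniteFieldBesicovitch4D, Prop. 1.3, proof (§3, p. 342)] -/
theorem mul_le_natCard_null_three [Finite K] [FiniteDimensional K V] (hB : B.Nondegenerate)
    (hBs : B.IsSymm) (h2 : (2 : K) ≠ 0) (hV : finrank K V = 3) :
    (Nat.card K - 1) * (Nat.card K - 2) ≤ Nat.card {v : V // v ≠ 0 ∧ B v v = 0} := by
  classical
  haveI := Fintype.ofFinite K
  have : Finite V := Module.finite_of_finite K
  obtain ⟨u, -, hu⟩ := exists_apply_self_ne_zero hB hBs h2 (U := ⊤)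
    (by rw [finrank_top, hV]; norm_num)
  have hu0 : u ≠ 0 := ne_zero_of_apply_self_ne_zero hu
  have hU'2 : finrank K (B.orthogonal (K ∙ u)) = 2 := by
    rw [LinearMap.BilinForm.finrank_orthogonal hB, hV, finrank_span_singleton hu0]
  have hB' := LinearMap.BilinForm.restrict_nondegenerate_orthogonal_spanSingleton B hB hBs.isRefl hu
  have hBs' := isSymm_restrict hBs (B.orthogonal (K ∙ u))
  -- all null vectors, sliced along `u`
  have hall : (Nat.card K - 1) * (Nat.card K - 2) + 1 ≤ Nat.card {v : V // B v v = 0} := by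
    rw [natCard_level_eq_sum hBs hu 0]
    have hexc : (Finset.univ.filter (fun s : K => s = 0)).card ≤ 1 := by
      rw [Finset.card_le_one]
      intro a ha b hb
      simp only [Finset.mem_filter, Finset.mem_univ, true_and] at ha hb
      rw [ha, hb]
    have hmain : ∀ s : K, ¬ (s = 0) →
        Nat.card K - 2 ≤
          Nat.card {w : (B.orthogonal (K ∙ u)) // B (w : V) w = 0 - B u u * s ^ 2} := by
      intro s hs
      have hne : 0 - B u u * s ^ 2 ≠ 0 := by
        rw [zero_sub, neg_ne_zero]
        exact mul_ne_zero hu (pow_ne_zero 2 hs)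
      have h' : Nat.card K ≤
          Nat.card {w : (B.orthogonal (K ∙ u)) // B (w : V) w = 0 - B u u * s ^ 2} + 2 := by
        have h'' := card_le_natCard_level_two hB' hBs' h2 hU'2 hne
        simp only [LinearMap.BilinForm.restrict_apply, LinearMap.domRestrict_apply] at h''
        exact h''
      omega
    have h := sub_mul_le_sum
      (fun s : K => Nat.card {w : (B.orthogonal (K ∙ u)) // B (w : V) w = 0 - B u u * s ^ 2})
      (fun s : K => s = 0) hexc hmain
    rw [← Nat.card_eq_fintype_card] at h
    -- the term `s = 0` contributes at least the zero vector
    have h0 :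
        1 ≤ Nat.card {w : (B.orthogonal (K ∙ u)) // B (w : V) w = 0 - B u u * (0 : K) ^ 2} := by
      have : Nonempty {w : (B.orthogonal (K ∙ u)) // B (w : V) w = 0 - B u u * (0 : K) ^ 2} :=
        ⟨⟨0, by simp⟩⟩
      exact Nat.one_le_iff_ne_zero.2 (Nat.card_ne_zero.2 ⟨this, inferInstance⟩)
    have hsplit := Finset.add_sum_erase Finset.univ
      (fun s : K => Nat.card {w : (B.orthogonal (K ∙ u)) // B (w : V) w = 0 - B u u * s ^ 2})
      (Finset.mem_univ (0 : K))
    have hrest : (Nat.card K - 1) * (Nat.card K - 2) ≤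
        ∑ s ∈ Finset.univ.erase (0 : K),
          Nat.card {w : (B.orthogonal (K ∙ u)) // B (w : V) w = 0 - B u u * s ^ 2} := by
      have h1 : (Finset.univ.erase (0 : K)).card • (Nat.card K - 2) ≤
          ∑ s ∈ Finset.univ.erase (0 : K),
            Nat.card {w : (B.orthogonal (K ∙ u)) // B (w : V) w = 0 - B u u * s ^ 2} :=
        Finset.card_nsmul_le_sum _ _ _ (fun s hs => hmain s (Finset.ne_of_mem_erase hs))
      rw [Finset.card_erase_of_mem (Finset.mem_univ _), Finset.card_univ,
        ← Nat.card_eq_fintype_card, smul_eq_mul] at h1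
      exact h1
    rw [← hsplit]
    omega
  -- remove the zero vector
  have e : {v : V // B v v = 0} ≃ Option {v : V // v ≠ 0 ∧ B v v = 0} :=
    { toFun := fun v => if h : (v : V) = 0 then none else some ⟨v, h, v.2⟩
      invFun := fun o => match o with
        | none => ⟨0, by simp⟩
        | some w => ⟨w.1, w.2.2⟩
      left_inv := fun v => by
        by_cases h : (v : V) = 0
        · simp only [h, dite_true]
          exact Subtype.ext h.symm
        · simp only [h, dite_false]
      right_inv := fun o => by
        cases o with
        | none => simp
        | some w => simp [w.2.1] }
  rw [Nat.card_congr e, Finite.card_option] at hall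
  omega

/-- **`|P| ≳ |F|³`, explicitly `q (q − 2)² ≤ |P|`** (`B` nondegenerate symmetric on a `4`-space
over `𝔽_q`, `q` odd): Tao's Lemma 3.1, (3–2), "`|P| ∼ |F|³`", lower half.
[cite: Tao2005FiniteFieldBesicovitch4D, Prop. 1.3 (§1, p. 338)] -/
theorem mul_sq_le_ncard_sphere [Finite K] [FiniteDimensional K V] (hB : B.Nondegenerate)
    (hBs : B.IsSymm) (h2 : (2 : K) ≠ 0) (h4 : finrank K V = 4) :
    Nat.card K * ((Nat.card K - 2) * (Nat.card K - 2)) ≤ (sphere B).ncard := by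
  classical
  haveI := Fintype.ofFinite K
  have : Finite V := Module.finite_of_finite K
  obtain ⟨u, -, hu⟩ := exists_apply_self_ne_zero hB hBs h2 (U := ⊤)
    (by rw [finrank_top, h4]; norm_num)
  have hu0 : u ≠ 0 := ne_zero_of_apply_self_ne_zero hu
  have hU'3 : finrank K (B.orthogonal (K ∙ u)) = 3 := by
    rw [LinearMap.BilinForm.finrank_orthogonal hB, h4, finrank_span_singleton hu0]
  have hB' := LinearMap.BilinForm.restrict_nondegenerate_orthogonal_spanSingleton B hB hBs.isRefl hu
  have hBs' := isSymm_restrict hBs (B.orthogonal (K ∙ u))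
  rw [← Nat.card_coe_set_eq, show (Nat.card (sphere B)) = Nat.card {v : V // B v v = 1} from rfl,
    natCard_level_eq_sum hBs hu 1]
  have hmain : ∀ s : K, (Nat.card K - 2) * (Nat.card K - 2) ≤
      Nat.card {w : (B.orthogonal (K ∙ u)) // B (w : V) w = 1 - B u u * s ^ 2} := by
    intro s
    have h' := sq_le_natCard_level_three hB' hBs' h2 hU'3 (1 - B u u * s ^ 2)
    simp only [LinearMap.BilinForm.restrict_apply, LinearMap.domRestrict_apply] at h'
    exact h'
  have h := Finset.card_nsmul_le_sum Finset.univ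
    (fun s : K => Nat.card {w : (B.orthogonal (K ∙ u)) // B (w : V) w = 1 - B u u * s ^ 2}) _
    (fun s _ => hmain s)
  rwa [Finset.card_univ, ← Nat.card_eq_fintype_card, smul_eq_mul] at h

/-- The nonzero null vectors orthogonal to a unit vector `x`, as vectors of the `3`-space `x^⊥`.
[folklore] -/
def nullPerpEquiv (hBs : B.IsSymm) (x : V) :
    {v : V // v ≠ 0 ∧ B v x = 0 ∧ B v v = 0} ≃
      {w : B.orthogonal (K ∙ x) // w ≠ 0 ∧ B (w : V) w = 0} where
  toFun v := ⟨⟨v.1, (mem_orthogonal_span_singleton_iff hBs).2 v.2.2.1⟩,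
    fun h => v.2.1 (congrArg Subtype.val h), v.2.2.2⟩
  invFun w := ⟨w.1.1, fun h => w.2.1 (Subtype.ext h),
    (mem_orthogonal_span_singleton_iff hBs).1 w.1.2, w.2.2⟩
  left_inv _ := rfl
  right_inv _ := rfl

/-- **`#(generating pairs) ≥ |P| · (q − 1)(q − 2)`:** through each unit vector `x`, the `3`-space
`x^⊥` is nondegenerate and carries at least `(q − 1)(q − 2)` nonzero null vectors.
[cite: Tao2005FiniteFieldBesicovitch4D, Prop. 1.3, proof (§3, p. 342)] -/
theorem ncard_sphere_mul_le_genPairs [Finite K] [FiniteDimensional K V] (hB : B.Nondegenerate)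
    (hBs : B.IsSymm) (h2 : (2 : K) ≠ 0) (h4 : finrank K V = 4) :
    (sphere B).ncard * ((Nat.card K - 1) * (Nat.card K - 2)) ≤ (genPairs B).ncard := by
  classical
  haveI := Fintype.ofFinite K
  have : Finite V := Module.finite_of_finite K
  haveI := Fintype.ofFinite V
  have e : genPairs B ≃ Σ x : V, {v : V // v ≠ 0 ∧ B x x = 1 ∧ B v x = 0 ∧ B v v = 0} :=
    Equiv.subtypeProdEquivSigmaSubtype
      (fun (x v : V) => v ≠ 0 ∧ B x x = 1 ∧ B v x = 0 ∧ B v v = 0)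
  rw [← Nat.card_coe_set_eq (genPairs B), Nat.card_congr e, Nat.card_sigma]
  have hfib : ∀ x : V, B x x = 1 → (Nat.card K - 1) * (Nat.card K - 2) ≤
      Nat.card {v : V // v ≠ 0 ∧ B x x = 1 ∧ B v x = 0 ∧ B v v = 0} := by
    intro x hx
    have hx0 : B x x ≠ 0 := by rw [hx]; exact one_ne_zero
    have hxne : x ≠ 0 := ne_zero_of_apply_self_ne_zero hx0
    have hU3 : finrank K (B.orthogonal (K ∙ x)) = 3 := by
      rw [LinearMap.BilinForm.finrank_orthogonal hB, h4, finrank_span_singleton hxne]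
    have hB' :=
      LinearMap.BilinForm.restrict_nondegenerate_orthogonal_spanSingleton B hB hBs.isRefl hx0
    have hBs' := isSymm_restrict hBs (B.orthogonal (K ∙ x))
    have h' := mul_le_natCard_null_three hB' hBs' h2 hU3
    simp only [LinearMap.BilinForm.restrict_apply, LinearMap.domRestrict_apply] at h'
    have e' : {v : V // v ≠ 0 ∧ B x x = 1 ∧ B v x = 0 ∧ B v v = 0} ≃
        {v : V // v ≠ 0 ∧ B v x = 0 ∧ B v v = 0} :=
      Equiv.subtypeEquivRight (fun v => by simp [hx])
    rw [Nat.card_congr (e'.trans (nullPerpEquiv hBs x))]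
    exact h'
  have hsum := Finset.card_nsmul_le_sum (Finset.univ.filter (fun x : V => B x x = 1))
    (fun x : V => Nat.card {v : V // v ≠ 0 ∧ B x x = 1 ∧ B v x = 0 ∧ B v v = 0}) _
    (fun x hx => hfib x (Finset.mem_filter.1 hx).2)
  have hcard : (Finset.univ.filter (fun x : V => B x x = 1)).card = (sphere B).ncard := by
    rw [← Set.ncard_coe_finset, Finset.coe_filter]
    simp only [Finset.mem_univ, true_and]
    rfl
  rw [hcard, smul_eq_mul] at hsum
  exact hsum.trans (Finset.sum_le_sum_of_subset (Finset.filter_subset _ _))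

/-- **`|L| ≳ |F|³`, explicitly `(q − 2)³ ≤ |L|`** (`B` nondegenerate symmetric on a `4`-space over
`𝔽_q`, `q` odd). [cite: Tao2005FiniteFieldBesicovitch4D, Prop. 1.3 (§1, p. 338)] -/
theorem cube_le_ncard_lineSet [Finite K] [FiniteDimensional K V] (hB : B.Nondegenerate)
    (hBs : B.IsSymm) (h2 : (2 : K) ≠ 0) (h4 : finrank K V = 4) :
    (Nat.card K - 2) ^ 3 ≤ (lineSet B).ncard := by
  have hP := mul_sq_le_ncard_sphere hB hBs h2 h4
  have hpairs := ncard_sphere_mul_le_genPairs hB hBs h2 h4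
  have heq := ncard_lineSet_mul_eq (B := B) hBs
  rw [Nat.card_units] at heq
  have hq := two_lt_card (K := K) h2
  -- q (q−1) |L| = #pairs ≥ |P| (q−1)(q−2) ≥ q (q−2)² (q−1)(q−2)
  obtain ⟨r, hr⟩ : ∃ r, Nat.card K = r + 2 := ⟨Nat.card K - 2, by omega⟩
  rw [hr] at hP hpairs heq ⊢
  simp only [Nat.add_sub_cancel, show r + 2 - 1 = r + 1 by omega] at hP hpairs heq ⊢
  have hpos : 0 < (r + 2) * (r + 1) := by positivity
  refine Nat.le_of_mul_le_mul_right ?_ hpos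
  calc r ^ 3 * ((r + 2) * (r + 1)) = ((r + 2) * (r * r)) * ((r + 1) * r) := by ring
    _ ≤ (sphere B).ncard * ((r + 1) * r) := Nat.mul_le_mul_right _ hP
    _ ≤ (genPairs B).ncard := hpairs
    _ = (lineSet B).ncard * ((r + 2) * (r + 1)) := heq.symm

end LowerBound

section Capstone

variable [Finite K] [FiniteDimensional K V] {B : LinearMap.BilinForm K V}

/-- **Proposition 1.3 (Tao 2005) for a general nondegenerate symmetric form, with explicit
constants.**  Let `K = 𝔽_q` with `q` odd (`(2 : K) ≠ 0`), `V` a `4`-dimensional `K`-space and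
`B = ⟨ , ⟩` a nondegenerate symmetric bilinear form on `V`; let `P = {x : ⟨x, x⟩ = 1}` and `L` the
set of lines `{x + t v}` with `v ≠ 0`, `⟨x, x⟩ = 1`, `⟨v, x⟩ = 0`, `⟨v, v⟩ = 0`.  Then
(i) `P` contains all the lines in `L`; (ii) `q (q − 2)² ≤ |P| ≤ 2 q³` ("`|P| ∼ |F|³`");
(iii) `(q − 2)³ ≤ |L| ≤ 6 q³` ("`|L| ∼ |F|³`"); (iv) `L` obeys the Wolff axiom (Definition 1.1,
`n = 4`): every affine `2`-plane `x₀ + W` contains at most `2` lines of `L` and every affine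
`3`-space `x₀ + U` at most `8 q`.
[cite: Tao2005FiniteFieldBesicovitch4D, Prop. 1.3 (§1, p. 338)] -/
theorem prop13 (hB : B.Nondegenerate) (hBs : B.IsSymm) (h2 : (2 : K) ≠ 0)
    (h4 : finrank K V = 4) :
    (∀ ℓ ∈ lineSet B, ℓ ⊆ sphere B) ∧
      (Nat.card K * ((Nat.card K - 2) * (Nat.card K - 2)) ≤ (sphere B).ncard ∧
        (sphere B).ncard ≤ 2 * Nat.card K ^ 3) ∧
      ((Nat.card K - 2) ^ 3 ≤ (lineSet B).ncard ∧ (lineSet B).ncard ≤ 6 * Nat.card K ^ 3) ∧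
      (∀ (W : Submodule K V) (x₀ : V), finrank K W = 2 →
        (lineSetIn B (translate x₀ W)).ncard ≤ 2) ∧
      ∀ (U : Submodule K V) (x₀ : V), finrank K U = 3 →
        (lineSetIn B (translate x₀ U)).ncard ≤ 8 * Nat.card K :=
  ⟨fun _ hℓ => subset_sphere_of_mem_lineSet hBs hℓ,
    ⟨mul_sq_le_ncard_sphere hB hBs h2 h4, ncard_sphere_le hB hBs h2 h4⟩,
    ⟨cube_le_ncard_lineSet hB hBs h2 h4, ncard_lineSet_le hB hBs h2 h4 (two_lt_card h2)⟩,
    (wolffAxiom hB hBs h2 h4).1, (wolffAxiom hB hBs h2 h4).2⟩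

/-- **Proposition 1.3 on `F⁴ = Fin 4 → K`**, literally as printed (the form is a nondegenerate
symmetric bilinear form `⟨ , ⟩ : F⁴ × F⁴ → F`).
[cite: Tao2005FiniteFieldBesicovitch4D, Prop. 1.3 (§1, p. 338)] -/
theorem prop13_fin {B : LinearMap.BilinForm K (Fin 4 → K)} (hB : B.Nondegenerate)
    (hBs : B.IsSymm) (h2 : (2 : K) ≠ 0) :
    (∀ ℓ ∈ lineSet B, ℓ ⊆ sphere B) ∧
      (Nat.card K * ((Nat.card K - 2) * (Nat.card K - 2)) ≤ (sphere B).ncard ∧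
        (sphere B).ncard ≤ 2 * Nat.card K ^ 3) ∧
      ((Nat.card K - 2) ^ 3 ≤ (lineSet B).ncard ∧ (lineSet B).ncard ≤ 6 * Nat.card K ^ 3) ∧
      (∀ (W : Submodule K (Fin 4 → K)) (x₀ : Fin 4 → K), finrank K W = 2 →
        (lineSetIn B (translate x₀ W)).ncard ≤ 2) ∧
      ∀ (U : Submodule K (Fin 4 → K)) (x₀ : Fin 4 → K), finrank K U = 3 →
        (lineSetIn B (translate x₀ U)).ncard ≤ 8 * Nat.card K :=
  prop13 hB hBs h2 (Module.finrank_fin_fun K)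

end Capstone



end Tao2005UnitSphere

end Literature.Combinatorics.Kakeya

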